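import Mathlib
import Literature.NumberTheory.LFunctions.Zhang2022.SkeletonPartThree
import HarnessLib

/-!
# Zhang (2022), typed statements: §12 «Evaluation of Ξ₁₅», first part — (12.1)–(12.9) and the
# smoothing `H₁₅ → H̃₁₅ → Z(s,ψχ)H̄₁₆(1−s,ψ̄)` (PDF pp. 66–68, tex L3354–L3470)

Topic `Literature/NumberTheory/LFunctions/Zhang2022` (Landau–Siegel audit tree; verdict-neutral).
Y. Zhang, *Discrete mean estimates and the Landau–Siegel zero*, arXiv:2211.02515v1 (2022)
[Zhang2022LandauSiegel] — **an unrefereed manuscript under adjudication. Every `def … : Prop` below is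
a CLAIM OF THE MANUSCRIPT, STATED NOT ASSERTED; nothing here asserts or denies its Theorems 1–2.**
The three `theorem`s are definitional bookkeeping (`H₁H₂ = B + H₁₅H₂`, the real-character form of
`𝐚₂₅`) and an elementary counting remark ("at most one `l`"), all kernel-checked.

This is the D-0069 statement-typing of the DAG nodes `Z22:(12.1) … Z22:§12.u017` (cell siegel-zhang,
`plan/L3/ASSIGNMENTS.md` v1 row L3-t4, file `TypedSection12A.lean`): every numbered display and every
proof-intermediate display / claim of §12 up to (12.9), statement-exact, constants verbatim
(`0.504`, `0.5`, `0.496`, `β₆`, `𝓛⁻¹⁰`, `η_± = exp{±𝓛⁻¹⁰}`, `ε = exp{−c𝓛¹⁰}`), over the banked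
skeleton objects (`Skeleton*`, cited by fully-qualified name, never restated). Locators are PDF pages
of arXiv:2211.02515v1 and lines of its TeX source `lsz3__2_.tex`.

| DAG node | locator | decl here (namespace `…Zhang2022.Typed.Sec12A`) or banked skeleton decl |
|---|---|---|
| Z22:(12.1) | p.66 L3361 | banked: `Skeleton.H14`, `Skeleton.H15`, `Skeleton.H11_eq_H14_add_H15` (PROVED) |
| Z22:§12.u001 | p.66 L3365 | `H1_mul_H2_eq` (PROVED: `H₁H₂ = B + H₁₅H₂`) |
| Z22:(12.2) | p.66 L3369 | banked: `Skeleton.Bpoly` |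
| Z22:(12.3) | p.66 L3373 | banked: `Skeleton.xi13_eq_xi14_add_xi15` (PROVED) |
| Z22:(12.4), (12.5) | p.66 L3377, L3380 | banked: `Skeleton.xi14`, `Skeleton.xi15` |
| Z22:§12.u002 | p.66 L3386 | `vk12` (object `ϰ₁₂`) |
| Z22:§12.u003 | p.66 L3390 | `Htilde15` (object `H̃₁₅`) |
| Z22:(12.6) | p.66 L3394 | `ms126`, `Eq126` |
| Z22:§12.u004 | p.66 L3400 | `IntG504` |
| Z22:§12.u005 | p.66 L3404 | `Vk12SubVk1Small` |
| Z22:§12.u006 | p.67 L3408 | `Vk12SubVk1Edges` |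
| (prose) | p.67 L3415 | `Ded126` ("These bounds together with (8.25) and (8.26) imply (12.6)") |
| Z22:§12.u007 | p.67 L3417 | `frakt` (object `𝔱`), `fraktRow`, `FraktRowSmall` |
| (prose) | p.67 L3420 | `eq_of_frakt_mul_eq_one` (PROVED: "at most one `l` such that `𝔱(dl) = 1`") |
| Z22:§12.u008 | p.67 L3421 | `fraktCol`, `FraktDoubleSum` |
| Z22:§12.u009 | p.67 L3427 | `dualTerm`, `dualPrefactor`, `Htilde15ApproxFE` |
| Z22:§12.u010 | p.67 L3431 | banked: `Skeleton.P1pp`, `Skeleton.P2pp` (`P″₁`, `P″₂`) |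
| (prose) | p.67 L3434 | `DualTailsSmall` ("By (4) and (4), the terms with … contribute `≪ ε`") |
| Z22:§12.u011, u012 | p.67 L3435, L3437 | `IntGDual` (u011 is its range hypothesis) |
| Z22:(12.8) | p.67 L3441 | `ms128`, `Eq128`; `msE2shift`, `E2ShiftMeanSq`, `Ded128` (its "in a way similar to the proof of Proposition 2.6") |
| Z22:§12.u013 | p.67 L3445 | `Hbar16` (object `H̄₁₆`) |
| Z22:§12.u014 | p.68 L3449 | `xi15viaHbar16`, `Xi15Hbar16`, `Ded1214` ("By (12.7) and (12.8)") |
| Z22:(12.9) | p.68 L3453 | `Eq129`, `Ded129` ("This implies, by Lemma 8.1") |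
| Z22:§12.u015 | p.68 L3457 | `a15` (object `𝐚₁₅`) |
| Z22:§12.u016 | p.68 L3461 | banked: `Skeleton.vk13` (`ϰ₁₃`) |
| Z22:§12.u017 | p.68 L3468 | `a25` (object `𝐚₂₅`), `a25_eq_of_isQuadratic` |

Conventions (those of the skeleton, `SkeletonPropositions` / `SkeletonPartTwo`; see the cell's
`skel/INTERFACE.md`): the standing "`D` sufficiently large, `χ (mod D)` real primitive" is
`Skeleton.ForAllLarge`, Assumption (A) an antecedent inside it; "`X ≪ ε`" with the manuscript's
`ε = exp{−c𝓛¹⁰}` (§4 p. 19, tex L1062) is `∃ c > 0, ∃ C, … ≤ C·exp(−c𝓛¹⁰)` (as in `Skeleton.Lemma111`);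
"`≪ 𝓛⁻¹⁰`" is `∃ C, … ≤ C·(𝓛¹⁰)⁻¹`; "`= o(𝔞𝔓)`" / "`+ o(𝔓)`" are `∀ ε > 0, … ≤ ε·𝔞𝔓` / `≤ ε·𝔓`;
discrete means `ΣΣ𝔠*(ρ,ψ)|…|²ω(ρ)` use `Re 𝔠*` and `Re ω` (real on the critical line) exactly as
`Skeleton.xi11`, `Skeleton.xi3sq`; the zero set written `Z̃(ψ)` in §12 is the `𝔷(ψ)` of (2.14)
(`Skeleton.zeroSet`, index set `Skeleton.idx`), as throughout the skeleton. The deduction nodes `Ded…`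
name the manuscript's inference sentences as implications between named nodes; their docstrings
separate the inputs the sentence CITES from the TACIT ones a Cauchy–Schwarz / mean-value step uses
(listed so that the implication is dischargeable as stated; cf. `Skeleton.prop26_of_evals`).

Printed-reference defects inside this span (recorded, not repaired; cf. the cell's `LOCATORS.md`):
"(8.25) and (8.26)" (L3415) do not exist in v1 (§8 ends at (8.24)); "(4) and (4)" (L3434) and
"the proof of (10.)" (L3436) are truncated references; "(12.7)" (L3448) is never defined (the
numbering jumps (12.6) → (12.8)); (12.8) prints `H̄₁₆(1−s,ψ̄)` inside a sum over `ρ` (read `s = ρ`);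
the display L3400 mixes `y` (integrand) and `n` (range and right side).

Deliberately NOT here: Lemma 12.1 onward ((12.10)–(12.17), Lemmas 12.1–12.3: `TypedSection12B/C`,
banked `Skeleton.Lemma121`, `Skeleton.Lemma123`, `Skeleton.Eval1217`, `Skeleton.Ded1217`); any proof
of a CLAIM node; any new named fact (none is introduced: every `def … : Prop` is a node of the
manuscript, not a literature prerequisite).

## References

* Y. Zhang, arXiv:2211.02515v1 (2022), §12 pp. 66–68, (12.1)–(12.9); §11 pp. 62–66 (Lemmas 11.1–11.2,
  `η_±`, `g̃`, `E(s,ψ)`); §8 Lemma 8.1; §4 (4.1)–(4.3) (`g`), p. 19 (`ε`).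
  [cite: Zhang2022LandauSiegel, §12 (12.1)–(12.9)]
-/

noncomputable section

open Complex Real ComplexConjugate
open Literature.NumberTheory.LFunctions.Zhang2022
open Literature.NumberTheory.LFunctions.Zhang2022.Skeleton

namespace Literature.NumberTheory.LFunctions.Zhang2022.Typed.Sec12A

/-! ## Objects depending on `D` only: `ϰ₁₂`, `𝔱` and its row/column sums -/

section ObjectsD

variable (D : ℕ)

/-- **`ϰ₁₂(y) = (1/0.504)(P₁/y)^{β₆}∫_{0.5}^{0.504}{g(P^z/y) − g(P^{0.5}/y)}dz`** (§12 p. 66, "Write",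
tex L3386; DAG node Z22:§12.u002), with `g` the weight (4.1) (`Skeleton.gW`), `P₁ = P^{0.504}`
(`Skeleton.P1`), `β₆ = 3iα/2` (`Skeleton.beta6`). [cite: Zhang2022LandauSiegel, §12 p. 66] -/
def vk12 (y : ℝ) : ℂ :=
  ((1 / 0.504 : ℝ) : ℂ) * ((Skeleton.P1 D / y : ℝ) : ℂ) ^ beta6 D *
    ((∫ z in (0.5 : ℝ)..0.504, (gW D (bigP D ^ z / y) - gW D (bigP D ^ (0.5 : ℝ) / y)) : ℝ) : ℂ)

/-- **`𝔱(y)`**, "the characteristic function of the interval `(P^{0.5}η₋, P^{0.5}η₊]`" (§12 p. 67,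
tex L3415–L3416; DAG node Z22:§12.u007), `η_± = exp{±𝓛⁻¹⁰}` (`Skeleton.etaPM D (±1)`).
[cite: Zhang2022LandauSiegel, §12 p. 67] -/
def frakt (y : ℝ) : ℝ :=
  if bigP D ^ (0.5 : ℝ) * etaPM D (-1) < y ∧ y ≤ bigP D ^ (0.5 : ℝ) * etaPM D 1 then 1 else 0

/-- The truncation point `N = ⌊P^{0.5}η₊⌋` for the `𝔱`-sums of p. 67: `𝔱(dl) = 0` unless
`dl ≤ P^{0.5}η₊`, so for `d, l ≥ 1` every non-zero term has `d, l ≤ N` and the printed sums over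
all `l` (resp. all `d`) equal the finite sums below. [cite: Zhang2022LandauSiegel, §12 p. 67] -/
def fraktN : ℕ := ⌊bigP D ^ (0.5 : ℝ) * etaPM D 1⌋₊

/-- **`Σ_l 𝔱(dl)/l`** (§12 p. 67, tex L3418 and L3422; DAG nodes Z22:§12.u007–u008), the sum over
`l ≥ 1` (finite, see `fraktN`). [cite: Zhang2022LandauSiegel, §12 p. 67] -/
def fraktRow (d : ℕ) : ℝ := ∑ l ∈ Finset.Icc 1 (fraktN D), frakt D ((d * l : ℕ) : ℝ) / (l : ℝ)

/-- **`Σ_d 𝔱(dl)/d`** (§12 p. 67, tex L3422–L3423, the inner sum on the right of the display;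
DAG node Z22:§12.u008), the sum over `d ≥ 1` (finite, see `fraktN`). [cite: Zhang2022LandauSiegel, §12 p. 67] -/
def fraktCol (l : ℕ) : ℝ := ∑ d ∈ Finset.Icc 1 (fraktN D), frakt D ((d * l : ℕ) : ℝ) / (d : ℝ)

end ObjectsD

/-! ## Objects depending on `χ`, `ψ`: `H̃₁₅`, the dual sum, `H̄₁₆`, `𝐚₁₅`, `𝐚₂₅` -/

section Objects

variable (c' : ℝ) {D : ℕ} [NeZero D] (χ : DirichletCharacter ℂ D) (x : Chr D)

/-- **`H̃₁₅(s,ψ) = Σ_{P^{0.5}η₋ < n < P₁η₊} ϰ₁₂(n)ψχ(n)n^{−s}`** (§12 p. 66, tex L3390; DAG node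
Z22:§12.u003); `ψχ(n)` is `Skeleton.pc`. [cite: Zhang2022LandauSiegel, §12 p. 66] -/
def Htilde15 (s : ℂ) : ℂ :=
  ∑ n ∈ (Finset.Ico 1 ⌈Skeleton.P1 D * etaPM D 1⌉₊).filter
      (fun n : ℕ => bigP D ^ (0.5 : ℝ) * etaPM D (-1) < n ∧ (n : ℝ) < Skeleton.P1 D * etaPM D 1),
    vk12 D n * pc χ x n * (n : ℂ) ^ (-s)

/-- The `n`-th term **`χψ̄(n) n^{−(1−s−β₆)} ∫_{0.496}^{0.5}{g(P^{0.5}Dt₀/n) − g(P^zDt₀/n)}dz`** of the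
dual sum in the approximate functional equation for `H̃₁₅` (§12 p. 67, display tex L3427–L3429;
DAG node Z22:§12.u009). [cite: Zhang2022LandauSiegel, §12 p. 67] -/
def dualTerm (s : ℂ) (n : ℕ) : ℂ :=
  χ (n : ZMod D) * conj (x.ψ (n : ZMod x.p)) / (n : ℂ) ^ (1 - s - beta6 D) *
    ((∫ z in (0.496 : ℝ)..0.5,
        (gW D (bigP D ^ (0.5 : ℝ) * D * t0 D / n) - gW D (bigP D ^ z * D * t0 D / n)) : ℝ) : ℂ)

/-- The prefactor **`Z(s+β₆,ψχ)P₁^{β₆}/0.504`** of the same display (§12 p. 67, tex L3428;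
DAG node Z22:§12.u009); `Z(·,ψχ)` is `Skeleton.Zpc`. [cite: Zhang2022LandauSiegel, §12 p. 67] -/
def dualPrefactor (s : ℂ) : ℂ :=
  Zpc χ x (s + beta6 D) * ((Skeleton.P1 D : ℂ) ^ beta6 D) / ((0.504 : ℝ) : ℂ)

/-- **`H̄₁₆(1−s,ψ̄) = (1/log P₁) Σ_{P″₁<n<P″₂} χψ̄(n) n^{−(1−s)} (n/P″₁)^{β₆} log(n/P″₁)`** (§12 p. 67,
"where", tex L3445; DAG node Z22:§12.u013), as a function of `w = 1 − s`; `P″₁ = P^{0.496}Dt₀`,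
`P″₂ = P^{0.5}Dt₀` are `Skeleton.P1pp`, `Skeleton.P2pp`. [cite: Zhang2022LandauSiegel, §12 p. 67] -/
def Hbar16 (w : ℂ) : ℂ :=
  (((Real.log (Skeleton.P1 D))⁻¹ : ℝ) : ℂ) *
    ∑ n ∈ (Finset.Ico 1 ⌈P2pp D⌉₊).filter (fun n : ℕ => P1pp D < n ∧ (n : ℝ) < P2pp D),
      χ (n : ZMod D) * conj (x.ψ (n : ZMod x.p)) * (n : ℂ) ^ (-w) *
        ((n / P1pp D : ℝ) : ℂ) ^ beta6 D * (Real.log (n / P1pp D) : ℂ)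

/-- **`a₁₅(n) = χ(n)ϰ₁₃(n)`** (§12 p. 68, "where", tex L3457; DAG node Z22:§12.u015), with
`ϰ₁₃` = `Skeleton.vk13` (display tex L3461, DAG node Z22:§12.u016, banked).
[cite: Zhang2022LandauSiegel, §12 p. 68] -/
def a15 (n : ℕ) : ℂ := χ (n : ZMod D) * vk13 D n

/-- **`a₂₅(n) = conj a₁₅(n)`** (§12 p. 68, tex L3468; DAG node Z22:§12.u017).
[cite: Zhang2022LandauSiegel, §12 p. 68] -/
def a25 (n : ℕ) : ℂ := conj (a15 χ n)

omit [NeZero D] in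
/-- For a real (quadratic) `χ`, `a₂₅(n) = χ(n)ϰ̄₁₃(n)` — the form `χ(l)ϰ̄₁₃(drl)` in which Lemma 12.3
consumes it (§12 p. 70). [cite: Zhang2022LandauSiegel, §12 p. 68] -/
theorem a25_eq_of_isQuadratic (hq : χ.IsQuadratic) (n : ℕ) :
    a25 χ n = χ (n : ZMod D) * conj (vk13 D n) := by
  rw [a25, a15, map_mul]
  congr 1
  rcases hq (n : ZMod D) with h | h | h <;> simp [h]

/-! ## (12.1)–(12.5): the split (banked in the skeleton) and `H₁H₂ = B + H₁₅H₂` -/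

omit [NeZero D] in
/-- **§12 p. 66, tex L3365 (DAG node Z22:§12.u001): "We can write `H₁(s,ψ)H₂(s,ψ) = B(s,ψ) + H₁₅(s,ψ)H₂(s,ψ)`
with `B = (H₁₄ + ι₂H₁₂)H₂` (12.2)"** — by (12.1) `H₁₁ = H₁₄ + H₁₅` (`Skeleton.H11_eq_H14_add_H15`) and
(2.27) `H₁ = H₁₁ + ι₂H₁₂`. Kernel-checked bookkeeping. [cite: Zhang2022LandauSiegel, §12 (12.2) p. 66] -/
theorem H1_mul_H2_eq (s : ℂ) :
    H1 χ x s * H2 χ x s = Bpoly χ x s + H15 χ x s * H2 χ x s := by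
  rw [H1, H11_eq_H14_add_H15, Bpoly]
  ring

end Objects

/-! ## (12.6) and the bounds for `ϰ₁₂ − ϰ₁` (pp. 66–67) -/

section Smoothing

variable (c' : ℝ) {D : ℕ} [NeZero D] (χ : DirichletCharacter ℂ D)

/-- The left side of (12.6): **`Σ_{ψ∈Ψ₁}Σ_{ρ∈𝔷(ψ)} 𝔠*(ρ,ψ)|H₁₅(ρ,ψ) − H̃₁₅(ρ,ψ)|²ω(ρ)`** (§12 p. 66,
tex L3394; DAG node Z22:(12.6)). [cite: Zhang2022LandauSiegel, §12 (12.6) p. 66] -/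
def ms126 : ℝ := ∑ i ∈ idx χ, (cstar c' D i.1 i.2).re *
  ‖H15 χ i.1 i.2 - Htilde15 χ i.1 i.2‖ ^ 2 * (omegaW D i.2).re

/-- **(12.6)** (§12 p. 66, tex L3394; DAG node Z22:(12.6)): "We first claim that
`Σ_{ψ∈Ψ₁}Σ_{ρ∈𝔷(ψ)} 𝔠*(ρ,ψ)|H₁₅(ρ,ψ) − H̃₁₅(ρ,ψ)|²ω(ρ) = o(𝔞𝔓)`." CLAIM.
[cite: Zhang2022LandauSiegel, §12 (12.6) p. 66] -/
def Eq126 : Prop :=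
  ∀ ε : ℝ, 0 < ε → ForAllLarge fun D _ χ => AssumptionA D χ →
    |ms126 c' χ| ≤ ε * frakA χ * frakP D

/-- **§12 p. 66, tex L3400 (DAG node Z22:§12.u004): "By the argument in the last section, for
`P^{0.5}η₊ < n < P₁η₋`, `∫_{0.5}^{0.504} g(P^z/y)dz = (log P₁ − log n)/log P + O(ε)`"** (printed with
`y` in the integrand and `n` in the range and on the right; typed for a real `y` in that range),
`ε = exp{−c𝓛¹⁰}`. CLAIM. [cite: Zhang2022LandauSiegel, §12 p. 66] -/
def IntG504 : Prop :=
  ∃ c : ℝ, 0 < c ∧ ∃ C : ℝ, ForAllLarge fun D _ _ => ∀ y : ℝ,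
    bigP D ^ (0.5 : ℝ) * etaPM D 1 < y → y < Skeleton.P1 D * etaPM D (-1) →
      |(∫ z in (0.5 : ℝ)..0.504, gW D (bigP D ^ z / y)) -
          (Real.log (Skeleton.P1 D) - Real.log y) / Real.log (bigP D)| ≤ C * Real.exp (-c * ell D ^ 10)

/-- **§12 p. 66, tex L3404 (DAG node Z22:§12.u005): "so that `ϰ₁₂(n) − ϰ₁(n) ≪ ε`"** for
`P^{0.5}η₊ < n < P₁η₋` (`ϰ₁` = `Skeleton.vk1`, `ε = exp{−c𝓛¹⁰}`). CLAIM.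
[cite: Zhang2022LandauSiegel, §12 p. 66] -/
def Vk12SubVk1Small : Prop :=
  ∃ c : ℝ, 0 < c ∧ ∃ C : ℝ, ForAllLarge fun D _ _ => ∀ n : ℕ,
    bigP D ^ (0.5 : ℝ) * etaPM D 1 < n → (n : ℝ) < Skeleton.P1 D * etaPM D (-1) →
      ‖vk12 D n - vk1 D n‖ ≤ C * Real.exp (-c * ell D ^ 10)

/-- **§12 p. 67, tex L3408 (DAG node Z22:§12.u006): "Also we have `ϰ₁₂(n) − ϰ₁(n) ≪ 𝓛⁻¹⁰` if
`P₁η₋ ≤ n < P₁η₊`, `≪ 1` if `P^{0.5}η₋ < n ≤ P^{0.5}η₊`."** CLAIM. [cite: Zhang2022LandauSiegel, §12 p. 67] -/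
def Vk12SubVk1Edges : Prop :=
  ∃ C : ℝ, ForAllLarge fun D _ _ => ∀ n : ℕ,
    (Skeleton.P1 D * etaPM D (-1) ≤ n → (n : ℝ) < Skeleton.P1 D * etaPM D 1 →
        ‖vk12 D n - vk1 D n‖ ≤ C * (ell D ^ 10)⁻¹) ∧
      (bigP D ^ (0.5 : ℝ) * etaPM D (-1) < n → (n : ℝ) ≤ bigP D ^ (0.5 : ℝ) * etaPM D 1 →
        ‖vk12 D n - vk1 D n‖ ≤ C)

/-- **§12 p. 67, tex L3416–L3418 (DAG node Z22:§12.u007): "If `d ≤ P^{0.5}(η₊ − η₋)`, then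
`Σ_l 𝔱(dl)/l ≪ 𝓛⁻¹⁰`."** CLAIM. [cite: Zhang2022LandauSiegel, §12 p. 67] -/
def FraktRowSmall : Prop :=
  ∃ C : ℝ, ForAllLarge fun D _ _ => ∀ d : ℕ, 1 ≤ d →
    (d : ℝ) ≤ bigP D ^ (0.5 : ℝ) * (etaPM D 1 - etaPM D (-1)) → fraktRow D d ≤ C * (ell D ^ 10)⁻¹

/-- **§12 p. 67, tex L3420: "If `d > P^{0.5}(η₊ − η₋)`, then there exists at most one `l` such that
`𝔱(dl) = 1`."** PROVED (two multiples of `d` in a half-open interval of length `< d` coincide).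
[cite: Zhang2022LandauSiegel, §12 p. 67] -/
theorem eq_of_frakt_mul_eq_one {D d l₁ l₂ : ℕ}
    (hd : bigP D ^ (0.5 : ℝ) * (etaPM D 1 - etaPM D (-1)) < d)
    (h₁ : frakt D ((d * l₁ : ℕ) : ℝ) = 1) (h₂ : frakt D ((d * l₂ : ℕ) : ℝ) = 1) : l₁ = l₂ := by
  -- `𝔱(y) = 1` puts `y` in the window `(P^{0.5}η₋, P^{0.5}η₊]`
  have key : ∀ {y : ℝ}, frakt D y = 1 →
      bigP D ^ (0.5 : ℝ) * etaPM D (-1) < y ∧ y ≤ bigP D ^ (0.5 : ℝ) * etaPM D 1 := by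
    intro y hy
    unfold frakt at hy
    split_ifs at hy with h
    · exact h
    · norm_num at hy
  have hd' : bigP D ^ (0.5 : ℝ) * etaPM D 1 - bigP D ^ (0.5 : ℝ) * etaPM D (-1) < d := by
    rw [← mul_sub]; exact hd
  have hd0 : (0 : ℝ) ≤ d := Nat.cast_nonneg d
  -- two distinct multiples of `d` do not fit in a window of length `< d`
  have step : ∀ {m₁ m₂ : ℕ}, frakt D ((d * m₁ : ℕ) : ℝ) = 1 → frakt D ((d * m₂ : ℕ) : ℝ) = 1 →
      ¬ m₁ < m₂ := by
    intro m₁ m₂ g₁ g₂ hlt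
    obtain ⟨a₁, -⟩ := key g₁
    obtain ⟨-, b₂⟩ := key g₂
    push_cast at a₁ b₂
    have h' : (m₁ : ℝ) + 1 ≤ m₂ := by exact_mod_cast hlt
    have hm := mul_le_mul_of_nonneg_left h' hd0
    rw [mul_add, mul_one] at hm
    linarith
  rcases lt_trichotomy l₁ l₂ with h | h | h
  · exact absurd h (step h₁ h₂)
  · exact h
  · exact absurd h (step h₂ h₁)

/-- **§12 p. 67, tex L3421–L3423 (DAG node Z22:§12.u008): "Hence
`Σ_{d>P^{0.5}(η₊−η₋)} (1/d)(Σ_l 𝔱(dl)/l) ≤ Σ_l (1/l²) Σ_d 𝔱(dl)/d ≪ 𝓛⁻¹⁰`"** (the outer `d`-sum carries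
the printed restriction; the inner `Σ_d` on the right is printed bare and typed over all `d ≥ 1`; all
sums finite, truncated at `fraktN` without loss). Typed as the pair (inequality, final bound). CLAIM.
[cite: Zhang2022LandauSiegel, §12 p. 67] -/
def FraktDoubleSum : Prop :=
  ∃ C : ℝ, ForAllLarge fun D _ _ =>
    (∑ d ∈ (Finset.Icc 1 (fraktN D)).filter
          (fun d : ℕ => bigP D ^ (0.5 : ℝ) * (etaPM D 1 - etaPM D (-1)) < d),
        (d : ℝ)⁻¹ * fraktRow D d ≤
      ∑ l ∈ Finset.Icc 1 (fraktN D), ((l : ℝ) ^ 2)⁻¹ * fraktCol D l) ∧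
    (∑ l ∈ Finset.Icc 1 (fraktN D), ((l : ℝ) ^ 2)⁻¹ * fraktCol D l ≤ C * (ell D ^ 10)⁻¹)

/-- **§12 p. 67, tex L3415: "These bounds together with (8.25) and (8.26) imply (12.6). We briefly
describe the argument as follows …"** — the inference as a named implication. CITED inputs: the
`ϰ₁₂ − ϰ₁` bounds (L3404, L3408) and the `𝔱`-sums (L3418, L3422); "(8.25), (8.26)" do NOT exist in
v1 (§8 ends at (8.24)) and are read, as for `Skeleton.Ded111`, as the discrete mean-value bounds
Lemma 8.1 + Proposition 7.1. TACIT (mean square on the critical line, `|A(𝐚;ρ)|² = A(𝐚;ρ,ψ)A(𝐚̄;1−ρ,ψ̄)`):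
Proposition 2.2 (i). CLAIM. [cite: Zhang2022LandauSiegel, §12 (12.6) p. 67] -/
def Ded126 : Prop :=
  IntG504 → Vk12SubVk1Small → Vk12SubVk1Edges → FraktRowSmall → FraktDoubleSum →
    Lemma81 c' → Prop71 c' → Prop22i → Eq126 c'

end Smoothing

/-! ## The approximate functional equation for `H̃₁₅` and (12.8) (p. 67) -/

section Reflection

variable (c' : ℝ) {D : ℕ} [NeZero D] (χ : DirichletCharacter ℂ D)

/-- **§12 p. 67, tex L3426–L3429 (DAG node Z22:§12.u009): "Assume `σ = 1/2`, `|t − 2πt₀| < 𝓛₁` and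
`0.5 ≤ z ≤ 0.504`. Using the proof of Lemma 11.2 with `s + β₆` in place of `s` we deduce that
`H̃₁₅(s,ψ) = (Z(s+β₆,ψχ)P₁^{β₆}/0.504) Σ_n χψ̄(n) n^{−(1−s−β₆)} ∫_{0.496}^{0.5}{g(P^{0.5}Dt₀/n) − g(P^zDt₀/n)}dz
+ O(E(s+β₆,ψ))`"** (`E(s,ψ)` of Lemma 11.2 = `Skeleton.E2main`; the `n`-sum is a series over all
`n ≥ 1`; the lead-in "`0.5 ≤ z ≤ 0.504`" is the pointwise range of the Lemma-11.2 step, `z` being the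
integration variable in the display). Typed for every `ψ ∈ Ψ`, as `Skeleton.Lemma112`. CLAIM.
[cite: Zhang2022LandauSiegel, §12 p. 67] -/
def Htilde15ApproxFE : Prop :=
  ∃ C : ℝ, ForAllLarge fun D _ χ => AssumptionA D χ → ∀ x : Chr D, ∀ s : ℂ, s.re = 1 / 2 →
    |s.im - 2 * π * t0 D| < ell1 D →
      ‖Htilde15 χ x s - dualPrefactor χ x s * ∑' n : ℕ, dualTerm χ x s n‖ ≤
        C * E2main χ x (s + beta6 D)

/-- **§12 p. 67, tex L3434: "By (4) and (4), the terms with `n ≤ P″₁η₋` or `n ≥ P″₂η₊` above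
contribute `≪ ε`"** ("(4) and (4)" is a truncated reference in v1 — presumably (4.2) and (4.3), the
tails of `g`; `ε = exp{−c𝓛¹⁰}`): the tail of the dual sum of the preceding display, prefactor
included, for `σ = 1/2`, `|t − 2πt₀| < 𝓛₁`. CLAIM. [cite: Zhang2022LandauSiegel, §12 p. 67] -/
def DualTailsSmall : Prop :=
  ∃ c : ℝ, 0 < c ∧ ∃ C : ℝ, ForAllLarge fun D _ χ => ∀ x : Chr D, ∀ s : ℂ, s.re = 1 / 2 →
    |s.im - 2 * π * t0 D| < ell1 D →
      ‖dualPrefactor χ x s *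
          ∑' n : ℕ, (if (n : ℝ) ≤ P1pp D * etaPM D (-1) ∨ P2pp D * etaPM D 1 ≤ n then
            dualTerm χ x s n else 0)‖ ≤ C * Real.exp (-c * ell D ^ 10)

/-- **§12 p. 67, tex L3434–L3439 (DAG nodes Z22:§12.u011 (the range) and Z22:§12.u012): "If
`P″₁η₊ < n < P″₂η₋`, then, in a way similar to the proof of (10.) [sic],
`∫_{0.496}^{0.5}{g(P^{0.5}Dt₀/n) − g(P^zDt₀/n)}dz = log n/log P − α̃ − 0.496 + O(ε)`"**
(`α̃ = log(Dt₀)/log P` = `Skeleton.alphaTilde`, `ε = exp{−c𝓛¹⁰}`). CLAIM.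
[cite: Zhang2022LandauSiegel, §12 p. 67] -/
def IntGDual : Prop :=
  ∃ c : ℝ, 0 < c ∧ ∃ C : ℝ, ForAllLarge fun D _ _ => ∀ n : ℕ,
    P1pp D * etaPM D 1 < n → (n : ℝ) < P2pp D * etaPM D (-1) →
      |(∫ z in (0.496 : ℝ)..0.5,
          (gW D (bigP D ^ (0.5 : ℝ) * D * t0 D / n) - gW D (bigP D ^ z * D * t0 D / n))) -
        (Real.log n / Real.log (bigP D) - alphaTilde D - 0.496)| ≤ C * Real.exp (-c * ell D ^ 10)

/-- The left side of (12.8): **`Σ_{ψ∈Ψ₁}Σ_{ρ∈𝔷(ψ)} 𝔠*(ρ,ψ)|Z(ρ,ψχ)⁻¹H̃₁₅(ρ,ψ) − H̄₁₆(1−ρ,ψ̄)|²ω(ρ)`**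
(§12 p. 67, tex L3441; printed `H̄₁₆(1−s,ψ̄)`, read `s = ρ`; DAG node Z22:(12.8)).
[cite: Zhang2022LandauSiegel, §12 (12.8) p. 67] -/
def ms128 : ℝ := ∑ i ∈ idx χ, (cstar c' D i.1 i.2).re *
  ‖(Zpc χ i.1 i.2)⁻¹ * Htilde15 χ i.1 i.2 - Hbar16 χ i.1 (1 - i.2)‖ ^ 2 * (omegaW D i.2).re

/-- **(12.8)** (§12 p. 67, tex L3440–L3443; DAG node Z22:(12.8)): "Thus, in a way similar to the
proof of Proposition 2.6, by the above discussion we deduce that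
`Σ_{ψ∈Ψ₁}Σ_{ρ∈𝔷(ψ)} 𝔠*(ρ,ψ)|Z(ρ,ψχ)⁻¹H̃₁₅(ρ,ψ) − H̄₁₆(1−s,ψ̄)|²ω(ρ) = o(𝔞𝔓)`." CLAIM.
[cite: Zhang2022LandauSiegel, §12 (12.8) p. 67] -/
def Eq128 : Prop :=
  ∀ ε : ℝ, 0 < ε → ForAllLarge fun D _ χ => AssumptionA D χ →
    |ms128 c' χ| ≤ ε * frakA χ * frakP D

/-- The mean square of the error term of the `H̃₁₅` formula, **`ΣΣ𝔠*(ρ,ψ)E(ρ+β₆,ψ)²ω(ρ)`** — the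
`s + β₆` counterpart of the last display of §11 (p. 66, tex L3350, `ΣΣ𝔠*E₂(ρ,ψ)²ω = o(𝔞𝔓)`), which
"in a way similar to the proof of Proposition 2.6" (p. 67, tex L3440) invokes implicitly.
[cite: Zhang2022LandauSiegel, §12 (12.8) p. 67] -/
def msE2shift : ℝ := ∑ i ∈ idx χ, (cstar c' D i.1 i.2).re *
  E2main χ i.1 (i.2 + beta6 D) ^ 2 * (omegaW D i.2).re

/-- **IMPLICIT in "in a way similar to the proof of Proposition 2.6" (§12 p. 67, tex L3440)**: the
`s + β₆` analogue `ΣΣ𝔠*(ρ,ψ)E(ρ+β₆,ψ)²ω(ρ) = o(𝔞𝔓)` of §11's closing claim (p. 66, tex L3350, there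
justified "by (8.25), (8.26) and simple estimates"). Not displayed in print; typed as the claim the
analogy requires. CLAIM. [cite: Zhang2022LandauSiegel, §12 (12.8) p. 67] -/
def E2ShiftMeanSq : Prop :=
  ∀ ε : ℝ, 0 < ε → ForAllLarge fun D _ χ => AssumptionA D χ →
    |msE2shift c' χ| ≤ ε * frakA χ * frakP D

/-- **§12 p. 67, tex L3440: "Thus, in a way similar to the proof of Proposition 2.6, by the above
discussion we deduce (12.8)"** — the inference as a named implication. CITED ("the above
discussion"): the `H̃₁₅` formula (L3427), the tails (L3434), the integral identity (L3437); BY ANALOGY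
with §11 (pp. 64–66): the discrete mean-value bounds Lemma 8.1 + Proposition 7.1 (§11's "(8.25),
(8.26)") and the mean square of `E(ρ+β₆,ψ)` (`E2ShiftMeanSq`); TACIT: Proposition 2.2 (i)
(`|Z(ρ,ψχ)| = 1`, `ρ̄ = 1 − ρ` on the critical line) and "`ψχ` primitive". CLAIM.
[cite: Zhang2022LandauSiegel, §12 (12.8) p. 67] -/
def Ded128 : Prop :=
  Htilde15ApproxFE → DualTailsSmall → IntGDual → E2ShiftMeanSq c' → Lemma81 c' → Prop71 c' →
    Prop22i → PsiChiPrimitive → Eq128 c'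

end Reflection

/-! ## From (12.6), (12.8) to `Ξ₁₅ = ΣΣ𝔠*H̄₁₆H₂ω + o(𝔓)` and (12.9) (p. 68) -/

section Evaluation

variable (c' : ℝ) {D : ℕ} [NeZero D] (χ : DirichletCharacter ℂ D)

/-- **`Σ_{ψ∈Ψ₁}Σ_{ρ∈𝔷(ψ)} 𝔠*(ρ,ψ)H̄₁₆(1−ρ,ψ̄)H₂(ρ,ψ)ω(ρ)`**, the main term of the display of p. 68
(tex L3449–L3451; DAG node Z22:§12.u014). [cite: Zhang2022LandauSiegel, §12 p. 68] -/
def xi15viaHbar16 : ℂ :=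
  ∑ i ∈ idx χ, cstar c' D i.1 i.2 * Hbar16 χ i.1 (1 - i.2) * H2 χ i.1 i.2 * omegaW D i.2

/-- **§12 p. 68, tex L3448–L3451 (DAG node Z22:§12.u014): "By (12.7) and (12.8) we obtain
`Ξ₁₅ = Σ_{ψ∈Ψ₁}Σ_{ρ∈𝔷(ψ)} 𝔠*(ρ,ψ)H̄₁₆(1−ρ,ψ̄)H₂(ρ,ψ)ω(ρ) + o(𝔓)`"** (`Ξ₁₅` = `Skeleton.xi15`, (12.5);
the printed error is `o(𝔓)`). CLAIM. [cite: Zhang2022LandauSiegel, §12 p. 68] -/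
def Xi15Hbar16 : Prop :=
  ∀ ε : ℝ, 0 < ε → ForAllLarge fun D _ χ => AssumptionA D χ →
    ‖xi15 c' χ - xi15viaHbar16 c' χ‖ ≤ ε * frakP D

/-- **§12 p. 68, tex L3448: "By (12.7) and (12.8) we obtain [the display]"** — the inference as a
named implication. CITED: "(12.7)", which is NOT a display of v1 (the numbering jumps (12.6) →
(12.8); the only candidate is (12.6), taken here) and (12.8). TACIT (the Cauchy–Schwarz passage from
`ΣΣ𝔠*Z⁻¹H₁₅H₂ω` to `ΣΣ𝔠*H̄₁₆H₂ω`, as in §11 p. 62 and `Skeleton.prop26_of_evals`): `Ξ₁₂ ≪ 𝔞𝔓` ((9.7),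
`Skeleton.Eval97`), `𝔠*(ρ,ψ) ≥ 0` (Lemma 2.3), Proposition 2.2 (i) and "`ψχ` primitive"
(`|Z(ρ,ψχ)| = 1`). CLAIM. [cite: Zhang2022LandauSiegel, §12 p. 68] -/
def Ded1214 : Prop :=
  Eq126 c' → Eq128 c' → Eval97 c' → Lemma23 c' → Prop22i → PsiChiPrimitive → Xi15Hbar16 c'

/-- **(12.9)** (§12 p. 68, tex L3452–L3455; DAG node Z22:(12.9)): "This implies, by Lemma 8.1,
`Ξ₁₅ = Θ₁(𝐚₁₂,𝐚₂₅) + conj Θ₁(𝐚₁₅,𝐚₂₂) + o(𝔓)` where `a₁₅(n) = χ(n)ϰ₁₃(n)` …, `a₂₅(n) = conj a₁₅(n)`"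
(`Θ₁` = `Skeleton.Theta1`, `𝐚₁₂, 𝐚₂₂` = `Skeleton.a12`, `Skeleton.a22` of (9.2)). CLAIM.
[cite: Zhang2022LandauSiegel, §12 (12.9) p. 68] -/
def Eq129 : Prop :=
  ∀ ε : ℝ, 0 < ε → ForAllLarge fun D _ χ => AssumptionA D χ →
    ‖xi15 c' χ - (Theta1 c' χ (a12 χ) (a25 χ) + conj (Theta1 c' χ (a15 χ) (a22 χ)))‖ ≤
      ε * frakP D

/-- **§12 p. 68, tex L3452: "This implies, by Lemma 8.1, (12.9)"** — the inference as a named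
implication: the preceding display (`Xi15Hbar16`) and Lemma 8.1 (`Skeleton.Lemma81`, with
`H₂(s,ψ) = A(𝐚₁₂;s,ψ)`, `H̄₁₆(1−s,ψ̄) = A(𝐚₂₅;1−s,ψ̄)`, `𝐚̄₂₅ = 𝐚₁₅`, `𝐚̄₁₂ = 𝐚₂₂`) give (12.9). CLAIM.
[cite: Zhang2022LandauSiegel, §12 (12.9) p. 68] -/
def Ded129 : Prop := Xi15Hbar16 c' → Lemma81 c' → Eq129 c'

end Evaluation


/-! ## Discharges: the `g`-integral identities of pp. 66–67 (DAG Z22:§12.u004, u005, u012)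

`IntG504`, `Vk12SubVk1Small` and `IntGDual` are THEOREMS: they follow from (4.2)–(4.3) and the
reflection `g(x) + g(1/x) = 1` ((11.4)), all proved in the tree's `Section4GaussianWeight`, by the
substitution `w = z·log P − log y`, under which `∫_{0.5}^{0.504} g(P^z/y)dz = (log P)⁻¹∫_a^b g(e^w)dw`
with `a ≤ −𝓛⁻¹⁰ < 0 < 𝓛⁻¹⁰ ≤ b`, and the identity `∫_a^b g(e^w)dw − b = ∫_b^{−a}(1 − g(e^w))dw`, whose
right side is at most `½e^{−𝓛¹⁰}(b − a)` in absolute value ("by the argument in the last section",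
§12 p. 66 — §11 p. 63, proof of Lemma 11.1). Constants obtained: `ε = e^{−𝓛¹⁰}` (`c = 1`), valid for
every `D ≥ 2`. -/

section Discharges

/-- `g(e^{−w}) = 1 − g(e^{w})`: the reflection (11.4) "`g(x) + g(1/x) = 1`" on the logarithmic scale
(tree: `GaussWeight.gWeight_eq_integral_Ioi`, `GaussWeight.one_sub_gWeight`).
[cite: Zhang2022LandauSiegel, §11 (11.4) p. 63] -/
theorem gW_exp_neg {D : ℕ} (hℓ : 0 < ell D) (w : ℝ) :
    gW D (Real.exp (-w)) = 1 - gW D (Real.exp w) := by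
  have hΛ : 0 < ell D ^ 30 := pow_pos hℓ 30
  rw [gW, gW, GaussWeight.one_sub_gWeight hΛ, GaussWeight.gWeight_eq_integral_Ioi, Real.log_exp,
    Real.log_exp, neg_neg]

/-- `w ↦ g(e^w)` is monotone ("the function `g(x)` is increasing", §4 after (4.1); tree
`GaussWeight.gWeight_mono`). [cite: Zhang2022LandauSiegel, §4 (4.1) p. 18] -/
theorem monotone_gW_exp {D : ℕ} (hℓ : 0 < ell D) : Monotone fun w : ℝ => gW D (Real.exp w) :=
  fun _ _ hvw =>
    GaussWeight.gWeight_mono (pow_pos hℓ 30) (Real.exp_pos _) (Real.exp_le_exp.mpr hvw)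

/-- `𝓛¹⁰ ≤ 𝓛³⁰u²` once `u² ≥ 𝓛⁻²⁰`: the exponent bookkeeping `Λ(𝓛⁻¹⁰)² = 𝓛¹⁰`, `Λ = 𝓛³⁰`.
[cite: Zhang2022LandauSiegel, §4 (4.2) p. 18] -/
theorem ell_pow_ten_le {D : ℕ} (hℓ : 0 < ell D) {u : ℝ} (hu : ((ell D ^ 10)⁻¹) ^ 2 ≤ u ^ 2) :
    ell D ^ 10 ≤ ell D ^ 30 * u ^ 2 := by
  have hℓ0 : ell D ≠ 0 := hℓ.ne'
  calc ell D ^ 10 = ell D ^ 30 * ((ell D ^ 10)⁻¹) ^ 2 := by field_simp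
    _ ≤ ell D ^ 30 * u ^ 2 := by gcongr

/-- (4.2) on the logarithmic scale at the manuscript's parameters (`Λ = 𝓛³⁰`): for `w ≥ 𝓛⁻¹⁰`,
`|1 − g(e^w)| ≤ ½e^{−𝓛¹⁰}` (`Λw² ≥ 𝓛¹⁰`). [cite: Zhang2022LandauSiegel, §4 (4.2) p. 18] -/
theorem abs_one_sub_gW_exp_le {D : ℕ} (hℓ : 0 < ell D) {w : ℝ} (hw : (ell D ^ 10)⁻¹ ≤ w) :
    |1 - gW D (Real.exp w)| ≤ 1 / 2 * Real.exp (-(ell D ^ 10)) := by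
  have hΛ : 0 < ell D ^ 30 := pow_pos hℓ 30
  have hm : 0 < (ell D ^ 10)⁻¹ := inv_pos.mpr (pow_pos hℓ 10)
  have hx : 1 ≤ Real.exp w := Real.one_le_exp (le_trans hm.le hw)
  obtain ⟨h0, h1⟩ := GaussWeight.one_sub_gWeight_le hΛ hx
  rw [gW, abs_of_nonneg h0]
  refine le_trans h1 ?_
  rw [Real.log_exp]
  have hkey : ell D ^ 10 ≤ ell D ^ 30 * w ^ 2 := ell_pow_ten_le hℓ (pow_le_pow_left₀ hm.le hw 2)
  refine mul_le_mul_of_nonneg_left (Real.exp_le_exp.mpr ?_) (by norm_num)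
  rw [neg_mul]
  exact neg_le_neg hkey

/-- (4.3) at the manuscript's parameters: for `0 < x ≤ e^{−𝓛⁻¹⁰}`, `g(x) ≤ ½e^{−𝓛¹⁰}`.
[cite: Zhang2022LandauSiegel, §4 (4.3) p. 18] -/
theorem gW_le_of_le_exp_neg {D : ℕ} (hℓ : 0 < ell D) {x : ℝ} (hx0 : 0 < x)
    (hx : x ≤ Real.exp (-(ell D ^ 10)⁻¹)) : gW D x ≤ 1 / 2 * Real.exp (-(ell D ^ 10)) := by
  have hΛ : 0 < ell D ^ 30 := pow_pos hℓ 30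
  have hm : 0 < (ell D ^ 10)⁻¹ := inv_pos.mpr (pow_pos hℓ 10)
  have hx1 : x ≤ 1 := le_trans hx (Real.exp_le_one_iff.mpr (by linarith))
  have hlog : Real.log x ≤ -(ell D ^ 10)⁻¹ := by
    have := Real.log_le_log hx0 hx
    rwa [Real.log_exp] at this
  refine le_trans (GaussWeight.gWeight_le hΛ hx0 hx1) ?_
  have hsq : ((ell D ^ 10)⁻¹) ^ 2 ≤ (Real.log x) ^ 2 := by
    have h1 : (ell D ^ 10)⁻¹ ≤ -Real.log x := by linarith
    calc ((ell D ^ 10)⁻¹) ^ 2 ≤ (-Real.log x) ^ 2 := pow_le_pow_left₀ hm.le h1 2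
      _ = (Real.log x) ^ 2 := by ring
  have hkey : ell D ^ 10 ≤ ell D ^ 30 * (Real.log x) ^ 2 := ell_pow_ten_le hℓ hsq
  change 1 / 2 * Real.exp (-(ell D ^ 30) * (Real.log x) ^ 2) ≤ 1 / 2 * Real.exp (-(ell D ^ 10))
  refine mul_le_mul_of_nonneg_left (Real.exp_le_exp.mpr ?_) (by norm_num)
  rw [neg_mul]
  exact neg_le_neg hkey

/-- The reflection computation behind "by the argument in the last section" (§12 p. 66, cf. the
proof of Lemma 11.1, §11 p. 63): for a monotone `h : ℝ → ℝ` with `h(−w) = 1 − h(w)` and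
`|1 − h(w)| ≤ δ` for `w ≥ m` (`m > 0`), and `a ≤ −m`, `m ≤ b`: `|∫_a^b h − b| ≤ δ(b − a)` — since
`∫_a^b h − b = ∫_b^{−a}(1 − h)` (the two `∫_0(1 − h)` cancel). [cite: Zhang2022LandauSiegel, §12 p. 66] -/
theorem abs_integral_sub_le_of_reflect {h : ℝ → ℝ} (hmono : Monotone h)
    (hrefl : ∀ w, h (-w) = 1 - h w) {m δ : ℝ} (hm : 0 < m) (hδ : ∀ w, m ≤ w → |1 - h w| ≤ δ)
    {a b : ℝ} (ha : a ≤ -m) (hb : m ≤ b) :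
    |(∫ w in a..b, h w) - b| ≤ δ * (b - a) := by
  have hi : ∀ x y : ℝ, IntervalIntegrable h MeasureTheory.volume x y :=
    fun x y => hmono.intervalIntegrable
  -- `∫_a^0 h = (−a) − ∫_0^{−a} h` by the reflection
  have h1 : ∫ w in a..0, h w = -a - ∫ w in (0 : ℝ)..-a, h w := by
    have e1 : ∫ v in (0 : ℝ)..-a, h (-v) = ∫ w in a..0, h w := by
      rw [intervalIntegral.integral_comp_neg]; simp
    have e2 : ∫ v in (0 : ℝ)..-a, h (-v) = ∫ v in (0 : ℝ)..-a, (1 - h v) :=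
      intervalIntegral.integral_congr fun v _ => hrefl v
    rw [← e1, e2, intervalIntegral.integral_sub intervalIntegrable_const (hi 0 (-a)),
      intervalIntegral.integral_const, smul_eq_mul, mul_one, sub_zero]
  -- `∫_a^b h − b = ∫_b^{−a} (1 − h)`
  have h2 : (∫ w in a..b, h w) - b = ∫ w in b..-a, (1 - h w) := by
    rw [← intervalIntegral.integral_add_adjacent_intervals (hi a 0) (hi 0 b), h1,
      intervalIntegral.integral_sub intervalIntegrable_const (hi b (-a)),
      intervalIntegral.integral_const, smul_eq_mul, mul_one,
      ← intervalIntegral.integral_interval_sub_left (hi 0 (-a)) (hi 0 b)]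
    ring
  rw [h2]
  have hδ0 : 0 ≤ δ := le_trans (abs_nonneg _) (hδ m le_rfl)
  have hbound : ∀ w ∈ Set.uIoc b (-a), ‖1 - h w‖ ≤ δ := by
    intro w hw
    rw [Real.norm_eq_abs]
    refine hδ w ?_
    rcases Set.mem_uIoc.mp hw with ⟨h1w, -⟩ | ⟨h1w, -⟩ <;> linarith
  calc |∫ w in b..-a, (1 - h w)| = ‖∫ w in b..-a, (1 - h w)‖ := (Real.norm_eq_abs _).symm
    _ ≤ δ * |-a - b| := intervalIntegral.norm_integral_le_of_norm_le_const hbound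
    _ ≤ δ * (b - a) := by
        refine mul_le_mul_of_nonneg_left (abs_le.mpr ⟨by linarith, by linarith⟩) hδ0

/-- `log P = 𝓛⁹` (`P = e^{𝓛⁹}`, (2.6)). [cite: Zhang2022LandauSiegel, §2 (2.6) p. 4] -/
theorem log_bigP (D : ℕ) : Real.log (bigP D) = ell D ^ 9 := by rw [bigP, Real.log_exp]

/-- `log P₁ = 0.504·𝓛⁹` (`P₁ = P^{0.504}`, (2.21)). [cite: Zhang2022LandauSiegel, §2 (2.21) p. 9] -/
theorem log_P1 (D : ℕ) : Real.log (Skeleton.P1 D) = 0.504 * ell D ^ 9 := by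
  rw [Skeleton.P1, Real.log_rpow (by rw [bigP]; exact Real.exp_pos _), log_bigP]

/-- For `D ≥ 2`: `𝓛 = log D > 0`. [cite: Zhang2022LandauSiegel, §2 (2.1) p. 4] -/
theorem ell_pos {D : ℕ} (hD : 2 ≤ D) : 0 < ell D := by
  have hD1 : (1 : ℝ) < D := by exact_mod_cast lt_of_lt_of_le one_lt_two hD
  exact Real.log_pos hD1

/-- The substitution `w = z·log P − d`: for `P = e^{𝓛⁹}`,
`∫_{z₁}^{z₂} g(e^{𝓛⁹z − d})dz = (𝓛⁹)⁻¹ ∫_{𝓛⁹z₁ − d}^{𝓛⁹z₂ − d} g(e^w)dw`.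
[cite: Zhang2022LandauSiegel, §12 p. 66] -/
theorem integral_gW_exp_comp {D : ℕ} (hℓ : 0 < ell D) (z₁ z₂ d : ℝ) :
    ∫ z in z₁..z₂, gW D (Real.exp (ell D ^ 9 * z - d)) =
      (ell D ^ 9)⁻¹ * ∫ w in ell D ^ 9 * z₁ - d..ell D ^ 9 * z₂ - d, gW D (Real.exp w) := by
  have h := intervalIntegral.integral_comp_mul_sub (a := z₁) (b := z₂)
    (fun w => gW D (Real.exp w)) (pow_pos hℓ 9).ne' d
  simpa only [smul_eq_mul] using h

/-- **The estimate of DAG node Z22:§12.u004 with explicit constants**: for `D ≥ 2` and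
`P^{0.5}η₊ < y < P₁η₋`, `|∫_{0.5}^{0.504} g(P^z/y)dz − (log P₁ − log y)/log P| ≤ e^{−𝓛¹⁰}`.
[cite: Zhang2022LandauSiegel, §12 p. 66] -/
theorem intG504_bound {D : ℕ} (hD : 2 ≤ D) {y : ℝ} (hy1 : bigP D ^ (0.5 : ℝ) * etaPM D 1 < y)
    (hy2 : y < Skeleton.P1 D * etaPM D (-1)) :
    |(∫ z in (0.5 : ℝ)..0.504, gW D (bigP D ^ z / y)) -
        (Real.log (Skeleton.P1 D) - Real.log y) / Real.log (bigP D)| ≤ Real.exp (-(ell D ^ 10)) := by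
  have hℓ : 0 < ell D := ell_pos hD
  have hL0 : 0 < ell D ^ 9 := pow_pos hℓ 9
  have hm : 0 < (ell D ^ 10)⁻¹ := inv_pos.mpr (pow_pos hℓ 10)
  -- the endpoints on the logarithmic scale
  have hlow : bigP D ^ (0.5 : ℝ) * etaPM D 1 = Real.exp (ell D ^ 9 * 0.5 + (ell D ^ 10)⁻¹) := by
    rw [bigP, ← Real.exp_mul, etaPM, one_mul, ← Real.exp_add]
  have hupp : Skeleton.P1 D * etaPM D (-1) =
      Real.exp (ell D ^ 9 * 0.504 + -(ell D ^ 10)⁻¹) := by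
    rw [Skeleton.P1, bigP, ← Real.exp_mul, etaPM, neg_one_mul, ← Real.exp_add]
  rw [hlow] at hy1
  rw [hupp] at hy2
  have hy0 : 0 < y := lt_trans (Real.exp_pos _) hy1
  have ha : ell D ^ 9 * 0.5 - Real.log y ≤ -(ell D ^ 10)⁻¹ := by
    have : ell D ^ 9 * 0.5 + (ell D ^ 10)⁻¹ < Real.log y := by
      rw [← Real.log_exp (ell D ^ 9 * 0.5 + (ell D ^ 10)⁻¹)]
      exact Real.log_lt_log (Real.exp_pos _) hy1
    linarith
  have hb : (ell D ^ 10)⁻¹ ≤ ell D ^ 9 * 0.504 - Real.log y := by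
    have : Real.log y < ell D ^ 9 * 0.504 + -(ell D ^ 10)⁻¹ := by
      rw [← Real.log_exp (ell D ^ 9 * 0.504 + -(ell D ^ 10)⁻¹)]
      exact Real.log_lt_log hy0 hy2
    linarith
  -- the substitution `w = z·log P − log y`
  have e : ∀ z : ℝ, gW D (bigP D ^ z / y) = gW D (Real.exp (ell D ^ 9 * z - Real.log y)) := by
    intro z
    rw [bigP, ← Real.exp_mul, Real.exp_sub, Real.exp_log hy0]
  have hsub : ∫ z in (0.5 : ℝ)..0.504, gW D (bigP D ^ z / y) =
      (ell D ^ 9)⁻¹ * ∫ w in ell D ^ 9 * 0.5 - Real.log y..ell D ^ 9 * 0.504 - Real.log y,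
        gW D (Real.exp w) := by
    simp_rw [e]
    exact integral_gW_exp_comp hℓ _ _ _
  have htarget : (Real.log (Skeleton.P1 D) - Real.log y) / Real.log (bigP D) =
      (ell D ^ 9)⁻¹ * (ell D ^ 9 * 0.504 - Real.log y) := by
    rw [log_P1, log_bigP]
    field_simp
  -- the reflection estimate
  have key := abs_integral_sub_le_of_reflect (monotone_gW_exp hℓ) (gW_exp_neg hℓ) hm
    (fun w hw => abs_one_sub_gW_exp_le hℓ hw) ha hb
  rw [hsub, htarget, ← mul_sub, abs_mul, abs_of_pos (inv_pos.mpr hL0)]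
  have hE := Real.exp_pos (-(ell D ^ 10))
  calc (ell D ^ 9)⁻¹ * |(∫ w in ell D ^ 9 * 0.5 - Real.log y..ell D ^ 9 * 0.504 - Real.log y,
          gW D (Real.exp w)) - (ell D ^ 9 * 0.504 - Real.log y)|
      ≤ (ell D ^ 9)⁻¹ * (1 / 2 * Real.exp (-(ell D ^ 10)) *
          (ell D ^ 9 * 0.504 - Real.log y - (ell D ^ 9 * 0.5 - Real.log y))) :=
        mul_le_mul_of_nonneg_left key (inv_pos.mpr hL0).le
    _ = 0.002 * Real.exp (-(ell D ^ 10)) := by field_simp; ring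
    _ ≤ Real.exp (-(ell D ^ 10)) := by linarith

/-- **DAG node Z22:§12.u004 DISCHARGED**: `IntG504` holds (with `ε = e^{−𝓛¹⁰}`, `c = C = 1`,
every `D ≥ 2`). [cite: Zhang2022LandauSiegel, §12 p. 66] -/
theorem intG504_holds : IntG504 :=
  ⟨1, one_pos, 1, 2, fun D _ _ hD _ _ y hy1 hy2 => by
    rw [one_mul, neg_one_mul]; exact intG504_bound hD hy1 hy2⟩

/-- `Re β₆ = 0` (`β₆ = 3iα/2` is purely imaginary). [cite: Zhang2022LandauSiegel, §2 (2.22) p. 9] -/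
theorem beta6_re (D : ℕ) : (beta6 D).re = 0 := by
  simp [beta6]

/-- `|(r)^{β₆}| = 1` for real `r > 0` (`β₆` purely imaginary). [cite: Zhang2022LandauSiegel, §2 (2.22) p. 9] -/
theorem norm_cpow_beta6 {D : ℕ} {r : ℝ} (hr : 0 < r) : ‖(r : ℂ) ^ beta6 D‖ = 1 := by
  rw [Complex.norm_cpow_eq_rpow_re_of_pos hr, beta6_re, Real.rpow_zero]

/-- **The estimate of DAG node Z22:§12.u005 with explicit constants**: for `D ≥ 2` and
`P^{0.5}η₊ < n < P₁η₋`, `|ϰ₁₂(n) − ϰ₁(n)| ≤ 2e^{−𝓛¹⁰}` — from `intG504_bound`, (4.3) for the term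
`g(P^{0.5}/n)` (`P^{0.5}/n < η₊⁻¹ = e^{−𝓛⁻¹⁰}`), `|(P₁/n)^{β₆}| = 1` and `log P₁ = 0.504 log P`.
[cite: Zhang2022LandauSiegel, §12 p. 66] -/
theorem vk12SubVk1Small_bound {D : ℕ} (hD : 2 ≤ D) {n : ℕ}
    (hn1 : bigP D ^ (0.5 : ℝ) * etaPM D 1 < n) (hn2 : (n : ℝ) < Skeleton.P1 D * etaPM D (-1)) :
    ‖vk12 D n - vk1 D n‖ ≤ 2 * Real.exp (-(ell D ^ 10)) := by
  have hℓ : 0 < ell D := ell_pos hD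
  have hL0 : 0 < ell D ^ 9 := pow_pos hℓ 9
  have hm : 0 < (ell D ^ 10)⁻¹ := inv_pos.mpr (pow_pos hℓ 10)
  have hP0 : 0 < bigP D := Real.exp_pos _
  have hPh : 0 < bigP D ^ (0.5 : ℝ) := Real.rpow_pos_of_pos hP0 _
  have hP1 : 0 < Skeleton.P1 D := Real.rpow_pos_of_pos hP0 _
  have hE := intG504_bound hD hn1 hn2
  have hn0 : (0 : ℝ) < n := lt_trans (mul_pos hPh (Real.exp_pos _)) hn1
  -- `n < P₁` (so `ϰ₁(n)` is given by its formula) and `P^{0.5}/n ≤ e^{−𝓛⁻¹⁰}`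
  have hη : etaPM D (-1) < 1 := by
    rw [etaPM, neg_one_mul]; exact Real.exp_lt_one_iff.mpr (by linarith)
  have hnP1 : (n : ℝ) < Skeleton.P1 D := by
    calc (n : ℝ) < Skeleton.P1 D * etaPM D (-1) := hn2
      _ < Skeleton.P1 D * 1 := by gcongr
      _ = Skeleton.P1 D := mul_one _
  have hratio : bigP D ^ (0.5 : ℝ) / n ≤ Real.exp (-(ell D ^ 10)⁻¹) := by
    rw [div_le_iff₀ hn0]
    have h1 : bigP D ^ (0.5 : ℝ) * etaPM D 1 * Real.exp (-(ell D ^ 10)⁻¹) ≤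
        n * Real.exp (-(ell D ^ 10)⁻¹) :=
      mul_le_mul_of_nonneg_right hn1.le (Real.exp_pos _).le
    have h2 : etaPM D 1 * Real.exp (-(ell D ^ 10)⁻¹) = 1 := by
      rw [etaPM, one_mul, ← Real.exp_add, add_neg_cancel, Real.exp_zero]
    calc bigP D ^ (0.5 : ℝ) = bigP D ^ (0.5 : ℝ) * (etaPM D 1 * Real.exp (-(ell D ^ 10)⁻¹)) := by
          rw [h2, mul_one]
      _ = bigP D ^ (0.5 : ℝ) * etaPM D 1 * Real.exp (-(ell D ^ 10)⁻¹) := by ring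
      _ ≤ n * Real.exp (-(ell D ^ 10)⁻¹) := h1
      _ = Real.exp (-(ell D ^ 10)⁻¹) * n := mul_comm _ _
  have hg0 : 0 < gW D (bigP D ^ (0.5 : ℝ) / n) := GaussWeight.gWeight_pos (pow_pos hℓ 30) _
  have hg1 : gW D (bigP D ^ (0.5 : ℝ) / n) ≤ 1 / 2 * Real.exp (-(ell D ^ 10)) :=
    gW_le_of_le_exp_neg hℓ (div_pos hPh hn0) hratio
  -- the integral of the difference
  have e : ∀ z : ℝ, gW D (bigP D ^ z / n) = gW D (Real.exp (ell D ^ 9 * z - Real.log n)) := by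
    intro z
    rw [bigP, ← Real.exp_mul, Real.exp_sub, Real.exp_log hn0]
  have hmono : Monotone fun z : ℝ => gW D (bigP D ^ z / n) := by
    intro z₁ z₂ hz
    simp only [e]
    exact monotone_gW_exp hℓ (by nlinarith)
  have hint : IntervalIntegrable (fun z : ℝ => gW D (bigP D ^ z / n)) MeasureTheory.volume 0.5 0.504 :=
    hmono.intervalIntegrable
  have hI : ∫ z in (0.5 : ℝ)..0.504, (gW D (bigP D ^ z / n) - gW D (bigP D ^ (0.5 : ℝ) / n)) =
      (∫ z in (0.5 : ℝ)..0.504, gW D (bigP D ^ z / n)) -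
        (0.504 - 0.5) * gW D (bigP D ^ (0.5 : ℝ) / n) := by
    rw [intervalIntegral.integral_sub hint intervalIntegrable_const, intervalIntegral.integral_const,
      smul_eq_mul]
  -- algebra: `ϰ₁₂(n) − ϰ₁(n) = (P₁/n)^{β₆}·((1/0.504)(I₁ − T) − (0.004/0.504)g(P^{0.5}/n))`
  set I₁ : ℝ := ∫ z in (0.5 : ℝ)..0.504, gW D (bigP D ^ z / n) with hI₁
  set T : ℝ := (Real.log (Skeleton.P1 D) - Real.log n) / Real.log (bigP D) with hT
  set g₀ : ℝ := gW D (bigP D ^ (0.5 : ℝ) / n) with hg₀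
  have hT' : 1 / 0.504 * T = 1 - Real.log n / Real.log (Skeleton.P1 D) := by
    rw [hT, log_P1, log_bigP]
    field_simp
  have halg : vk12 D n - vk1 D n =
      ((Skeleton.P1 D / n : ℝ) : ℂ) ^ beta6 D *
        (((1 / 0.504 * (I₁ - T) - (0.504 - 0.5) / 0.504 * g₀ : ℝ) : ℂ)) := by
    rw [vk1, if_pos hnP1, vk12, hI, ← hT']
    push_cast
    ring
  rw [halg, norm_mul, norm_cpow_beta6 (div_pos hP1 hn0), one_mul, Complex.norm_real,
    Real.norm_eq_abs]
  have hE' : |I₁ - T| ≤ Real.exp (-(ell D ^ 10)) := hE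
  have hexp := Real.exp_pos (-(ell D ^ 10))
  calc |1 / 0.504 * (I₁ - T) - (0.504 - 0.5) / 0.504 * g₀|
      ≤ |1 / 0.504 * (I₁ - T)| + |(0.504 - 0.5) / 0.504 * g₀| := abs_sub _ _
    _ = 1 / 0.504 * |I₁ - T| + (0.504 - 0.5) / 0.504 * g₀ := by
        rw [abs_mul, abs_mul, abs_of_pos (by norm_num : (0 : ℝ) < 1 / 0.504),
          abs_of_pos (by norm_num : (0 : ℝ) < (0.504 - 0.5) / 0.504), abs_of_pos hg0]
    _ ≤ 1 / 0.504 * Real.exp (-(ell D ^ 10)) +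
          (0.504 - 0.5) / 0.504 * (1 / 2 * Real.exp (-(ell D ^ 10))) := by gcongr
    _ ≤ 2 * Real.exp (-(ell D ^ 10)) := by nlinarith

/-- **DAG node Z22:§12.u005 DISCHARGED**: `Vk12SubVk1Small` holds (`ε = e^{−𝓛¹⁰}`, `c = 1`, `C = 2`,
every `D ≥ 2`). [cite: Zhang2022LandauSiegel, §12 p. 66] -/
theorem vk12SubVk1Small_holds : Vk12SubVk1Small :=
  ⟨1, one_pos, 2, 2, fun D _ _ hD _ _ n hn1 hn2 => by
    rw [neg_one_mul]; exact vk12SubVk1Small_bound hD hn1 hn2⟩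

/-- **The estimate of DAG node Z22:§12.u012 with explicit constants**: for `D ≥ 2` and
`P″₁η₊ < n < P″₂η₋`, `|∫_{0.496}^{0.5}{g(P^{0.5}Dt₀/n) − g(P^zDt₀/n)}dz − (log n/log P − α̃ − 0.496)|
≤ e^{−𝓛¹⁰}` — the substitution `w = z·log P − log(n/(Dt₀))`, `abs_integral_sub_le_of_reflect`, and
(4.2) for the term `g(P^{0.5}Dt₀/n)` (`P^{0.5}Dt₀/n > η₊ = e^{𝓛⁻¹⁰}`).
[cite: Zhang2022LandauSiegel, §12 p. 67] -/
theorem intGDual_bound {D : ℕ} (hD : 2 ≤ D) {n : ℕ} (hn1 : P1pp D * etaPM D 1 < n)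
    (hn2 : (n : ℝ) < P2pp D * etaPM D (-1)) :
    |(∫ z in (0.496 : ℝ)..0.5,
        (gW D (bigP D ^ (0.5 : ℝ) * D * t0 D / n) - gW D (bigP D ^ z * D * t0 D / n))) -
      (Real.log n / Real.log (bigP D) - alphaTilde D - 0.496)| ≤ Real.exp (-(ell D ^ 10)) := by
  have hℓ : 0 < ell D := ell_pos hD
  have hL0 : 0 < ell D ^ 9 := pow_pos hℓ 9
  have hm : 0 < (ell D ^ 10)⁻¹ := inv_pos.mpr (pow_pos hℓ 10)
  have hD0 : (0 : ℝ) < D := by exact_mod_cast lt_of_lt_of_le two_pos hD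
  have hK : 0 < (D : ℝ) * t0 D := mul_pos hD0 (pow_pos hℓ 519)
  -- the endpoints on the logarithmic scale
  set d : ℝ := Real.log n - Real.log ((D : ℝ) * t0 D) with hd
  have hlow : P1pp D * etaPM D 1 =
      Real.exp (ell D ^ 9 * 0.496 + (ell D ^ 10)⁻¹) * ((D : ℝ) * t0 D) := by
    rw [P1pp, bigP, ← Real.exp_mul, etaPM, one_mul, Real.exp_add]; ring
  have hupp : P2pp D * etaPM D (-1) =
      Real.exp (ell D ^ 9 * 0.5 + -(ell D ^ 10)⁻¹) * ((D : ℝ) * t0 D) := by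
    rw [P2pp, bigP, ← Real.exp_mul, etaPM, neg_one_mul, Real.exp_add]; ring
  rw [hlow] at hn1
  rw [hupp] at hn2
  have hn0 : (0 : ℝ) < n := lt_trans (mul_pos (Real.exp_pos _) hK) hn1
  have ha : ell D ^ 9 * 0.496 - d ≤ -(ell D ^ 10)⁻¹ := by
    have h1 := Real.log_lt_log (mul_pos (Real.exp_pos _) hK) hn1
    rw [Real.log_mul (Real.exp_pos _).ne' hK.ne', Real.log_exp] at h1
    rw [hd]; linarith
  have hb : (ell D ^ 10)⁻¹ ≤ ell D ^ 9 * 0.5 - d := by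
    have h1 := Real.log_lt_log hn0 hn2
    rw [Real.log_mul (Real.exp_pos _).ne' hK.ne', Real.log_exp] at h1
    rw [hd]; linarith
  -- the integrands on the logarithmic scale
  have e : ∀ z : ℝ, gW D (bigP D ^ z * D * t0 D / n) = gW D (Real.exp (ell D ^ 9 * z - d)) := by
    intro z
    rw [bigP, ← Real.exp_mul, hd, Real.exp_sub, Real.exp_sub, Real.exp_log hn0, Real.exp_log hK,
      div_div_eq_mul_div, mul_assoc]
  have hmono : Monotone fun z : ℝ => gW D (bigP D ^ z * D * t0 D / n) := by
    intro z₁ z₂ hz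
    simp only [e]
    exact monotone_gW_exp hℓ (by nlinarith)
  have hint : IntervalIntegrable (fun z : ℝ => gW D (bigP D ^ z * D * t0 D / n))
      MeasureTheory.volume 0.496 0.5 := hmono.intervalIntegrable
  -- `g(P^{0.5}Dt₀/n) = g(e^{b'})` with `b' ≥ 𝓛⁻¹⁰`
  set g₁ : ℝ := gW D (bigP D ^ (0.5 : ℝ) * D * t0 D / n) with hg₁
  have hg₁' : |1 - g₁| ≤ 1 / 2 * Real.exp (-(ell D ^ 10)) := by
    rw [hg₁, e]; exact abs_one_sub_gW_exp_le hℓ hb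
  -- the integral of the difference, and the substitution
  set I₂ : ℝ := ∫ w in ell D ^ 9 * 0.496 - d..ell D ^ 9 * 0.5 - d, gW D (Real.exp w) with hI₂
  have hI : ∫ z in (0.496 : ℝ)..0.5,
      (gW D (bigP D ^ (0.5 : ℝ) * D * t0 D / n) - gW D (bigP D ^ z * D * t0 D / n)) =
        (0.5 - 0.496) * g₁ - (ell D ^ 9)⁻¹ * I₂ := by
    rw [intervalIntegral.integral_sub intervalIntegrable_const hint, intervalIntegral.integral_const,
      smul_eq_mul]
    simp_rw [e]
    rw [integral_gW_exp_comp hℓ, hg₁, hI₂, e]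
  have key : |I₂ - (ell D ^ 9 * 0.5 - d)| ≤
      1 / 2 * Real.exp (-(ell D ^ 10)) * (ell D ^ 9 * 0.5 - d - (ell D ^ 9 * 0.496 - d)) :=
    abs_integral_sub_le_of_reflect (monotone_gW_exp hℓ) (gW_exp_neg hℓ) hm
      (fun w hw => abs_one_sub_gW_exp_le hℓ hw) ha hb
  -- the target on the logarithmic scale: `log n/log P − α̃ = d/𝓛⁹`
  have htarget : Real.log n / Real.log (bigP D) - alphaTilde D - 0.496 =
      (ell D ^ 9)⁻¹ * d - 0.496 := by
    rw [alphaTilde, log_bigP, hd]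
    field_simp
  have halg : (0.5 - 0.496) * g₁ - (ell D ^ 9)⁻¹ * I₂ - ((ell D ^ 9)⁻¹ * d - 0.496) =
      -((0.5 - 0.496) * (1 - g₁)) + -((ell D ^ 9)⁻¹ * (I₂ - (ell D ^ 9 * 0.5 - d))) := by
    field_simp
    ring
  rw [hI, htarget, halg]
  have hexp := Real.exp_pos (-(ell D ^ 10))
  calc |-((0.5 - 0.496) * (1 - g₁)) + -((ell D ^ 9)⁻¹ * (I₂ - (ell D ^ 9 * 0.5 - d)))|
      ≤ |-((0.5 - 0.496) * (1 - g₁))| + |-((ell D ^ 9)⁻¹ * (I₂ - (ell D ^ 9 * 0.5 - d)))| :=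
        abs_add_le _ _
    _ = (0.5 - 0.496) * |1 - g₁| + (ell D ^ 9)⁻¹ * |I₂ - (ell D ^ 9 * 0.5 - d)| := by
        rw [abs_neg, abs_neg, abs_mul, abs_mul, abs_of_pos (by norm_num : (0 : ℝ) < 0.5 - 0.496),
          abs_of_pos (inv_pos.mpr hL0)]
    _ ≤ (0.5 - 0.496) * (1 / 2 * Real.exp (-(ell D ^ 10))) + (ell D ^ 9)⁻¹ *
          (1 / 2 * Real.exp (-(ell D ^ 10)) * (ell D ^ 9 * 0.5 - d - (ell D ^ 9 * 0.496 - d))) := by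
        gcongr
    _ = 0.004 * Real.exp (-(ell D ^ 10)) := by field_simp; ring
    _ ≤ Real.exp (-(ell D ^ 10)) := by linarith

/-- **DAG node Z22:§12.u012 DISCHARGED**: `IntGDual` holds (`ε = e^{−𝓛¹⁰}`, `c = C = 1`, every
`D ≥ 2`). [cite: Zhang2022LandauSiegel, §12 p. 67] -/
theorem intGDual_holds : IntGDual :=
  ⟨1, one_pos, 1, 2, fun D _ _ hD _ _ n hn1 hn2 => by
    rw [one_mul, neg_one_mul]; exact intGDual_bound hD hn1 hn2⟩

end Discharges


/-! ## Discharge: the dual tails (prose claim p. 67, tex L3434)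

`DualTailsSmall` is a THEOREM. For `n ≤ P″₁η₋` every argument of `g` in the dual term is at least
`η₋⁻¹ = e^{𝓛⁻¹⁰}`, so by (4.2) the integrand is at most `e^{−𝓛¹⁰}`; for `n ≥ P″₂η₊` every argument is
at most `η₊⁻¹ = e^{−𝓛⁻¹⁰}` and (4.3) gives `g ≤ ½(P″₂/n)^{𝓛²⁰} ≤ ½(P″₂/n)²e^{2𝓛⁻¹⁰−𝓛¹⁰}`. With
`|χψ̄(n)n^{−(1−s−β₆)}| ≤ n^{−1/2} ≤ 1`, `|Z(s+β₆,ψχ)| = |P₁^{β₆}| = 1` and `Σ n⁻² = π²/6`, the tail is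
`≤ 0.004·(16/6)/0.504 · P″₂² e^{2𝓛⁻¹⁰−𝓛¹⁰} ≤ e^{−𝓛¹⁰/2}` once `𝓛 ≥ 4` (`P″₂² ≤ e^{𝓛⁹+1040𝓛}`).
Constants: `c = ½`, `C = 1`, `D ≥ e⁴`. -/

section DualTails

variable {D : ℕ} [NeZero D] (χ : DirichletCharacter ℂ D) (x : Chr D)

/-- `P ≥ 1` (`P = e^{𝓛⁹}`). [cite: Zhang2022LandauSiegel, §2 (2.6) p. 4] -/
theorem one_le_bigP' (D : ℕ) : 1 ≤ bigP D :=
  Real.one_le_exp (pow_nonneg (Real.log_natCast_nonneg D) 9)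

/-- (4.2) off the logarithmic scale: `|1 − g(y)| ≤ ½e^{−𝓛¹⁰}` for `y ≥ e^{𝓛⁻¹⁰}`.
[cite: Zhang2022LandauSiegel, §4 (4.2) p. 18] -/
theorem abs_one_sub_gW_le {D : ℕ} (hℓ : 0 < ell D) {y : ℝ} (hy : Real.exp ((ell D ^ 10)⁻¹) ≤ y) :
    |1 - gW D y| ≤ 1 / 2 * Real.exp (-(ell D ^ 10)) := by
  have hy0 : 0 < y := lt_of_lt_of_le (Real.exp_pos _) hy
  have hw : (ell D ^ 10)⁻¹ ≤ Real.log y := by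
    have h := Real.log_le_log (Real.exp_pos _) hy
    rwa [Real.log_exp] at h
  have h := abs_one_sub_gW_exp_le hℓ hw
  rwa [Real.exp_log hy0] at h

/-- (4.3) with power decay: for `0 < y ≤ r ≤ e^{−𝓛⁻¹⁰}`, `g(y) ≤ ½·r^{𝓛²⁰}` (`Λ log²r ≥ 𝓛²⁰|log r|`).
[cite: Zhang2022LandauSiegel, §4 (4.3) p. 18] -/
theorem gW_le_rpow {D : ℕ} (hℓ : 0 < ell D) {y r : ℝ} (hy0 : 0 < y) (hyr : y ≤ r)
    (hr : r ≤ Real.exp (-(ell D ^ 10)⁻¹)) : gW D y ≤ 1 / 2 * r ^ (ell D ^ 20) := by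
  have hΛ : 0 < ell D ^ 30 := pow_pos hℓ 30
  have hm : 0 < (ell D ^ 10)⁻¹ := inv_pos.mpr (pow_pos hℓ 10)
  have hr0 : 0 < r := lt_of_lt_of_le hy0 hyr
  have hr1 : r ≤ 1 := le_trans hr (Real.exp_le_one_iff.mpr (by linarith))
  have hy1 : y ≤ 1 := le_trans hyr hr1
  have hlogr : Real.log r ≤ -(ell D ^ 10)⁻¹ := by
    have h := Real.log_le_log hr0 hr
    rwa [Real.log_exp] at h
  have hlogy : Real.log y ≤ Real.log r := Real.log_le_log hy0 hyr
  have hL0 : Real.log r < 0 := by linarith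
  refine le_trans (GaussWeight.gWeight_le hΛ hy0 hy1) ?_
  refine mul_le_mul_of_nonneg_left ?_ (by norm_num)
  rw [Real.rpow_def_of_pos hr0]
  refine Real.exp_le_exp.mpr ?_
  have h1 : (Real.log r) ^ 2 ≤ (Real.log y) ^ 2 := by
    have hdiff : 0 ≤ Real.log r - Real.log y := by linarith
    have hsum : 0 ≤ -(Real.log y + Real.log r) := by linarith
    nlinarith [mul_nonneg hdiff hsum]
  have hLL : (ell D ^ 10)⁻¹ * (-Real.log r) ≤ Real.log r * Real.log r := by nlinarith
  have hℓ0 : ell D ≠ 0 := hℓ.ne'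
  have e1 : ell D ^ 20 = ell D ^ 30 * (ell D ^ 10)⁻¹ := by field_simp
  have hkey : ell D ^ 20 * (-Real.log r) ≤ ell D ^ 30 * (Real.log y) ^ 2 := by
    calc ell D ^ 20 * (-Real.log r) = ell D ^ 30 * ((ell D ^ 10)⁻¹ * (-Real.log r)) := by
          rw [e1]; ring
      _ ≤ ell D ^ 30 * (Real.log r * Real.log r) := by gcongr
      _ = ell D ^ 30 * (Real.log r) ^ 2 := by ring
      _ ≤ ell D ^ 30 * (Real.log y) ^ 2 := by gcongr
  linarith

/-- `r^{𝓛²⁰} ≤ r²·e^{2𝓛⁻¹⁰ − 𝓛¹⁰}` for `0 < r ≤ e^{−𝓛⁻¹⁰}` (`𝓛²⁰ ≥ 2`).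
[cite: Zhang2022LandauSiegel, §4 (4.3) p. 18] -/
theorem rpow_ell_twenty_le {D : ℕ} (hℓ : 0 < ell D) (hκ : 2 ≤ ell D ^ 20) {r : ℝ} (hr0 : 0 < r)
    (hr : r ≤ Real.exp (-(ell D ^ 10)⁻¹)) :
    r ^ (ell D ^ 20) ≤ r ^ 2 * Real.exp (2 * (ell D ^ 10)⁻¹ - ell D ^ 10) := by
  have hℓ0 : ell D ≠ 0 := hℓ.ne'
  have hsplit : r ^ (ell D ^ 20) = r ^ 2 * r ^ (ell D ^ 20 - 2) := by
    rw [← Real.rpow_two, ← Real.rpow_add hr0]; ring_nf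
  rw [hsplit]
  refine mul_le_mul_of_nonneg_left ?_ (pow_nonneg hr0.le 2)
  calc r ^ (ell D ^ 20 - 2) ≤ Real.exp (-(ell D ^ 10)⁻¹) ^ (ell D ^ 20 - 2) :=
        Real.rpow_le_rpow hr0.le hr (by linarith)
    _ = Real.exp (2 * (ell D ^ 10)⁻¹ - ell D ^ 10) := by
        rw [← Real.exp_mul]
        congr 1
        field_simp
        ring

omit [NeZero D] in
/-- `(1 − s − β₆).re = 1/2` on the critical line. [cite: Zhang2022LandauSiegel, §12 p. 67] -/
theorem re_one_sub_sub_beta6 {s : ℂ} (hs : s.re = 1 / 2) : (1 - s - beta6 D).re = 1 / 2 := by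
  simp only [Complex.sub_re, Complex.one_re, hs, beta6_re]
  norm_num

/-- The real integral `I(n) = ∫_{0.496}^{0.5}{g(P^{0.5}Dt₀/n) − g(P^zDt₀/n)}dz` inside the dual term.
[cite: Zhang2022LandauSiegel, §12 p. 67] -/
def dualInt (D n : ℕ) : ℝ :=
  ∫ z in (0.496 : ℝ)..0.5,
    (gW D (bigP D ^ (0.5 : ℝ) * D * t0 D / n) - gW D (bigP D ^ z * D * t0 D / n))

omit [NeZero D] in
/-- `|dualTerm(s,n)| ≤ |I(n)|` for `n ≥ 1` on the critical line (`|χ(n)|, |ψ̄(n)| ≤ 1`,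
`|n^{1−s−β₆}| = n^{1/2} ≥ 1`). [cite: Zhang2022LandauSiegel, §12 p. 67] -/
theorem norm_dualTerm_le {s : ℂ} (hs : s.re = 1 / 2) {n : ℕ} (hn : 1 ≤ n) :
    ‖dualTerm χ x s n‖ ≤ |dualInt D n| := by
  have hre : (1 - s - beta6 D).re = 1 / 2 := re_one_sub_sub_beta6 hs
  have hn0 : 0 < n := hn
  have hden : 1 ≤ ‖(n : ℂ) ^ (1 - s - beta6 D)‖ := by
    rw [Complex.norm_natCast_cpow_of_pos hn0, hre]
    exact Real.one_le_rpow (by exact_mod_cast hn) (by norm_num)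
  have hχ : ‖χ (n : ZMod D)‖ ≤ 1 := DirichletCharacter.norm_le_one χ _
  have hψ : ‖conj (x.ψ (n : ZMod x.p))‖ ≤ 1 := by
    rw [Complex.norm_conj]; exact DirichletCharacter.norm_le_one _ _
  have hrw : dualTerm χ x s n = χ (n : ZMod D) * conj (x.ψ (n : ZMod x.p)) /
      (n : ℂ) ^ (1 - s - beta6 D) * ((dualInt D n : ℝ) : ℂ) := rfl
  rw [hrw, norm_mul, norm_div, norm_mul, Complex.norm_real, Real.norm_eq_abs]
  have hI : 0 ≤ |dualInt D n| := abs_nonneg _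
  have hq : ‖χ (n : ZMod D)‖ * ‖conj (x.ψ (n : ZMod x.p))‖ / ‖(n : ℂ) ^ (1 - s - beta6 D)‖ ≤ 1 := by
    rw [div_le_one (lt_of_lt_of_le one_pos hden)]
    calc ‖χ (n : ZMod D)‖ * ‖conj (x.ψ (n : ZMod x.p))‖ ≤ 1 * 1 :=
          mul_le_mul hχ hψ (norm_nonneg _) zero_le_one
      _ = 1 := one_mul 1
      _ ≤ ‖(n : ℂ) ^ (1 - s - beta6 D)‖ := hden
  calc ‖χ (n : ZMod D)‖ * ‖conj (x.ψ (n : ZMod x.p))‖ / ‖(n : ℂ) ^ (1 - s - beta6 D)‖ * |dualInt D n|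
      ≤ 1 * |dualInt D n| := mul_le_mul_of_nonneg_right hq hI
    _ = |dualInt D n| := one_mul _

omit [NeZero D] in
/-- The dual term vanishes at `n = 0` (`0^{1−s−β₆} = 0`). [cite: Zhang2022LandauSiegel, §12 p. 67] -/
theorem dualTerm_zero {s : ℂ} (hs : s.re = 1 / 2) : dualTerm χ x s 0 = 0 := by
  have hne : (1 - s - beta6 D) ≠ 0 := by
    intro h
    have h2 := congrArg Complex.re h
    rw [re_one_sub_sub_beta6 hs, Complex.zero_re] at h2
    norm_num at h2
  simp only [dualTerm, Nat.cast_zero, Complex.zero_cpow hne, div_zero, zero_mul]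

/-- **Pointwise bound for the dual integrand in both tails**: for `n ≥ 1` with `n ≤ P″₁η₋` or
`n ≥ P″₂η₊` and `z ∈ [0.496, 0.5]`,
`|g(P^{0.5}Dt₀/n) − g(P^zDt₀/n)| ≤ (P″₂/n)²·e^{2𝓛⁻¹⁰ − 𝓛¹⁰}`. [cite: Zhang2022LandauSiegel, §12 p. 67] -/
theorem abs_dual_integrand_le {D : ℕ} (hℓ : 0 < ell D) (hκ : 2 ≤ ell D ^ 20) (hD0 : 0 < (D : ℝ))
    {n : ℕ} (hn : 1 ≤ n)
    (htail : (n : ℝ) ≤ P1pp D * etaPM D (-1) ∨ P2pp D * etaPM D 1 ≤ n)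
    {z : ℝ} (hz1 : 0.496 ≤ z) (hz2 : z ≤ 0.5) :
    |gW D (bigP D ^ (0.5 : ℝ) * D * t0 D / n) - gW D (bigP D ^ z * D * t0 D / n)| ≤
      (P2pp D / n) ^ 2 * Real.exp (2 * (ell D ^ 10)⁻¹ - ell D ^ 10) := by
  have hn0 : (0 : ℝ) < n := by exact_mod_cast hn
  have hP1 : 1 ≤ bigP D := one_le_bigP' D
  have hP0 : 0 < bigP D := lt_of_lt_of_le one_pos hP1
  have ht0 : 0 < t0 D := pow_pos hℓ 519
  have hm : 0 < (ell D ^ 10)⁻¹ := inv_pos.mpr (pow_pos hℓ 10)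
  have hzP : 0 < bigP D ^ z := Real.rpow_pos_of_pos hP0 z
  -- the arguments of `g` are squeezed between `P″₁/n` and `P″₂/n`
  have hlow : P1pp D / n ≤ bigP D ^ z * D * t0 D / n := by
    rw [P1pp]
    exact div_le_div_of_nonneg_right (mul_le_mul_of_nonneg_right
      (mul_le_mul_of_nonneg_right (Real.rpow_le_rpow_of_exponent_le hP1 hz1) hD0.le) ht0.le) hn0.le
  have hupp : bigP D ^ z * D * t0 D / n ≤ P2pp D / n := by
    rw [P2pp]
    exact div_le_div_of_nonneg_right (mul_le_mul_of_nonneg_right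
      (mul_le_mul_of_nonneg_right (Real.rpow_le_rpow_of_exponent_le hP1 hz2) hD0.le) ht0.le) hn0.le
  have hargz : 0 < bigP D ^ z * D * t0 D / n := by positivity
  have hmid : bigP D ^ (0.5 : ℝ) * D * t0 D / n = P2pp D / n := by rw [P2pp]
  rw [hmid]
  rcases htail with hA | hB
  · -- lower tail: both arguments are `≥ e^{𝓛⁻¹⁰}`
    have hthr : Real.exp ((ell D ^ 10)⁻¹) ≤ P1pp D / n := by
      rw [le_div_iff₀ hn0]
      have h1 : Real.exp ((ell D ^ 10)⁻¹) * n ≤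
          Real.exp ((ell D ^ 10)⁻¹) * (P1pp D * etaPM D (-1)) :=
        mul_le_mul_of_nonneg_left hA (Real.exp_pos _).le
      have h2 : Real.exp ((ell D ^ 10)⁻¹) * (P1pp D * etaPM D (-1)) = P1pp D := by
        rw [etaPM, neg_one_mul, mul_left_comm, ← Real.exp_add, add_neg_cancel, Real.exp_zero,
          mul_one]
      linarith
    have ha := abs_one_sub_gW_le hℓ (le_trans hthr (le_trans hlow hupp))
    have hb := abs_one_sub_gW_le hℓ (le_trans hthr hlow)
    have hratio : 1 ≤ P2pp D / n :=
      le_trans (Real.one_le_exp hm.le) (le_trans hthr (le_trans hlow hupp))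
    calc |gW D (P2pp D / n) - gW D (bigP D ^ z * D * t0 D / n)|
        = |(1 - gW D (bigP D ^ z * D * t0 D / n)) - (1 - gW D (P2pp D / n))| := by ring_nf
      _ ≤ |1 - gW D (bigP D ^ z * D * t0 D / n)| + |1 - gW D (P2pp D / n)| := abs_sub _ _
      _ ≤ 1 / 2 * Real.exp (-(ell D ^ 10)) + 1 / 2 * Real.exp (-(ell D ^ 10)) := add_le_add hb ha
      _ = 1 * Real.exp (-(ell D ^ 10)) := by ring
      _ ≤ (P2pp D / n) ^ 2 * Real.exp (2 * (ell D ^ 10)⁻¹ - ell D ^ 10) :=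
          mul_le_mul (by nlinarith) (Real.exp_le_exp.mpr (by linarith)) (Real.exp_pos _).le
            (by positivity)
  · -- upper tail: both arguments are `≤ e^{−𝓛⁻¹⁰}`
    have hthr : P2pp D / n ≤ Real.exp (-(ell D ^ 10)⁻¹) := by
      rw [div_le_iff₀ hn0]
      have h1 : P2pp D * etaPM D 1 * Real.exp (-(ell D ^ 10)⁻¹) ≤ n * Real.exp (-(ell D ^ 10)⁻¹) :=
        mul_le_mul_of_nonneg_right hB (Real.exp_pos _).le
      have h2 : P2pp D * etaPM D 1 * Real.exp (-(ell D ^ 10)⁻¹) = P2pp D := by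
        rw [etaPM, one_mul, mul_assoc, ← Real.exp_add, add_neg_cancel, Real.exp_zero, mul_one]
      linarith
    have hr0 : 0 < P2pp D / n := lt_of_lt_of_le hargz hupp
    have ha : gW D (P2pp D / n) ≤ 1 / 2 * (P2pp D / n) ^ (ell D ^ 20) :=
      gW_le_rpow hℓ hr0 le_rfl hthr
    have hb : gW D (bigP D ^ z * D * t0 D / n) ≤ 1 / 2 * (P2pp D / n) ^ (ell D ^ 20) :=
      gW_le_rpow hℓ hargz hupp hthr
    have hga : 0 < gW D (P2pp D / n) := GaussWeight.gWeight_pos (pow_pos hℓ 30) _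
    have hgb : 0 < gW D (bigP D ^ z * D * t0 D / n) := GaussWeight.gWeight_pos (pow_pos hℓ 30) _
    have hpow := rpow_ell_twenty_le hℓ hκ hr0 hthr
    calc |gW D (P2pp D / n) - gW D (bigP D ^ z * D * t0 D / n)|
        ≤ |gW D (P2pp D / n)| + |gW D (bigP D ^ z * D * t0 D / n)| := abs_sub _ _
      _ = gW D (P2pp D / n) + gW D (bigP D ^ z * D * t0 D / n) := by
          rw [abs_of_pos hga, abs_of_pos hgb]
      _ ≤ 1 / 2 * (P2pp D / n) ^ (ell D ^ 20) + 1 / 2 * (P2pp D / n) ^ (ell D ^ 20) :=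
          add_le_add ha hb
      _ = (P2pp D / n) ^ (ell D ^ 20) := by ring
      _ ≤ (P2pp D / n) ^ 2 * Real.exp (2 * (ell D ^ 10)⁻¹ - ell D ^ 10) := hpow

omit [NeZero D] in
/-- **The tail terms are dominated by `0.004·e^{2𝓛⁻¹⁰−𝓛¹⁰}·P″₂²/n²`** (`n ≥ 1` in either tail,
`σ = 1/2`). [cite: Zhang2022LandauSiegel, §12 p. 67] -/
theorem norm_dualTerm_tail_le (hℓ : 0 < ell D) (hκ : 2 ≤ ell D ^ 20) (hD0 : 0 < (D : ℝ))
    {s : ℂ} (hs : s.re = 1 / 2) {n : ℕ} (hn : 1 ≤ n)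
    (htail : (n : ℝ) ≤ P1pp D * etaPM D (-1) ∨ P2pp D * etaPM D 1 ≤ n) :
    ‖dualTerm χ x s n‖ ≤
      0.004 * Real.exp (2 * (ell D ^ 10)⁻¹ - ell D ^ 10) * P2pp D ^ 2 * (1 / (n : ℝ) ^ 2) := by
  refine le_trans (norm_dualTerm_le χ x hs hn) ?_
  have hbound : ∀ z ∈ Set.uIoc (0.496 : ℝ) 0.5,
      ‖gW D (bigP D ^ (0.5 : ℝ) * D * t0 D / n) - gW D (bigP D ^ z * D * t0 D / n)‖ ≤
        (P2pp D / n) ^ 2 * Real.exp (2 * (ell D ^ 10)⁻¹ - ell D ^ 10) := by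
    intro z hz
    rw [Set.uIoc_of_le (by norm_num), Set.mem_Ioc] at hz
    rw [Real.norm_eq_abs]
    exact abs_dual_integrand_le hℓ hκ hD0 hn htail hz.1.le hz.2
  have h := intervalIntegral.norm_integral_le_of_norm_le_const hbound
  rw [Real.norm_eq_abs] at h
  rw [dualInt]
  refine le_trans h (le_of_eq ?_)
  have hn0 : (n : ℝ) ≠ 0 := by exact_mod_cast (by omega : n ≠ 0)
  rw [abs_of_pos (by norm_num : (0 : ℝ) < 0.5 - 0.496)]
  field_simp
  ring

/-- `P″₂² ≤ e^{𝓛⁹ + 1040𝓛}` (`P″₂ = P^{0.5}Dt₀`, `D = e^{𝓛}`, `t₀ = 𝓛⁵¹⁹ ≤ e^{519𝓛}`).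
[cite: Zhang2022LandauSiegel, §12 p. 67] -/
theorem P2pp_sq_le {D : ℕ} (hD0 : 0 < (D : ℝ)) (hℓ : 0 < ell D) :
    P2pp D ^ 2 ≤ Real.exp (ell D ^ 9 + 1040 * ell D) := by
  have hP0 : 0 < bigP D := Real.exp_pos _
  have hsq : (bigP D ^ (0.5 : ℝ)) ^ 2 = bigP D := by
    rw [sq, ← Real.rpow_add hP0]; norm_num
  have hDexp : (D : ℝ) = Real.exp (ell D) := by rw [ell, Real.exp_log hD0]
  have ht0' : 0 ≤ t0 D := (pow_pos hℓ 519).le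
  have ht0 : t0 D ≤ Real.exp (ell D) ^ 519 := by
    rw [t0]
    exact pow_le_pow_left₀ hℓ.le (by linarith [Real.add_one_le_exp (ell D)]) 519
  calc P2pp D ^ 2 = bigP D * (D : ℝ) ^ 2 * t0 D ^ 2 := by
        rw [P2pp, mul_pow, mul_pow, hsq]
    _ ≤ bigP D * (D : ℝ) ^ 2 * (Real.exp (ell D) ^ 519) ^ 2 :=
        mul_le_mul_of_nonneg_left (pow_le_pow_left₀ ht0' ht0 2) (mul_nonneg hP0.le (sq_nonneg _))
    _ = Real.exp (ell D ^ 9) * Real.exp (ell D) ^ 2 * Real.exp (ell D) ^ 1038 := by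
        rw [bigP, hDexp, ← pow_mul]
    _ = Real.exp (ell D ^ 9 + 1040 * ell D) := by
        rw [← Real.exp_nat_mul, ← Real.exp_nat_mul, ← Real.exp_add, ← Real.exp_add]
        congr 1
        push_cast
        ring

/-- **The prose claim of §12 p. 67 (tex L3434) DISCHARGED**: `DualTailsSmall` holds with
`ε = e^{−𝓛¹⁰/2}` (`c = ½`, `C = 1`, all `D ≥ e⁴`): the terms with `n ≤ P″₁η₋` or `n ≥ P″₂η₊` of the
dual sum contribute `≪ ε`. [cite: Zhang2022LandauSiegel, §12 p. 67] -/
theorem dualTailsSmall_holds : DualTailsSmall := by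
  refine ⟨1 / 2, by norm_num, 1, ⌈Real.exp 4⌉₊, fun D _ χ hD hq hp x s hs ht => ?_⟩
  -- parameters
  have hD4 : Real.exp 4 ≤ D := le_trans (Nat.le_ceil _) (by exact_mod_cast hD)
  have hD0 : (0 : ℝ) < D := lt_of_lt_of_le (Real.exp_pos 4) hD4
  have hℓ4 : 4 ≤ ell D := by rw [ell, Real.le_log_iff_exp_le hD0]; exact hD4
  have hℓ : 0 < ell D := by linarith
  have hℓ1 : 1 ≤ ell D := by linarith
  have hD3 : 3 ≤ D := by
    have h5 : (4 : ℝ) + 1 ≤ Real.exp 4 := Real.add_one_le_exp 4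
    have h3 : (3 : ℝ) ≤ D := by linarith
    exact_mod_cast h3
  have hκ : 2 ≤ ell D ^ 20 :=
    le_trans (by norm_num : (2 : ℝ) ≤ 4 ^ 20) (pow_le_pow_left₀ (by norm_num) hℓ4 20)
  have hm : 0 < (ell D ^ 10)⁻¹ := inv_pos.mpr (pow_pos hℓ 10)
  have hm1 : (ell D ^ 10)⁻¹ ≤ 1 := inv_le_one_of_one_le₀ (one_le_pow₀ hℓ1)
  have hP0 : 0 < bigP D := lt_of_lt_of_le one_pos (one_le_bigP' D)
  have hP1 : 0 < Skeleton.P1 D := Real.rpow_pos_of_pos hP0 _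
  -- the prefactor has norm `1/0.504`
  have hprim := psiChiPrimitive_holds D χ x hD3 hp
  have hre' : (s + beta6 D).re = 1 / 2 := by simp [beta6_re, hs]
  have hα : 0 < alpha D := by rw [alpha, log_bigP]; positivity
  have himS : 0 < s.im := by
    have h1 : ell1 D ≤ 2 * π * t0 D := by
      rw [ell1, t0]
      have h2 : ell D ^ 405 ≤ ell D ^ 519 := pow_le_pow_right₀ hℓ1 (by norm_num)
      nlinarith [Real.pi_gt_three, pow_pos hℓ 519]
    have h3 := (abs_lt.mp ht).1
    linarith
  have him' : 0 < (s + beta6 D).im := by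
    have hb : (beta6 D).im = 3 * alpha D / 2 := by simp [beta6]
    rw [Complex.add_im, hb]; positivity
  have hZ : ‖Zpc χ x (s + beta6 D)‖ = 1 := norm_Zpc_eq_one χ hprim hre' him'
  have hpref : ‖dualPrefactor χ x s‖ = 1 / 0.504 := by
    rw [dualPrefactor, norm_div, norm_mul, hZ, norm_cpow_beta6 hP1, Complex.norm_real,
      Real.norm_eq_abs, abs_of_pos (by norm_num : (0 : ℝ) < 0.504), one_mul]
  -- the tail series is dominated by `K·Σ n⁻²`
  set K : ℝ := 0.004 * Real.exp (2 * (ell D ^ 10)⁻¹ - ell D ^ 10) * P2pp D ^ 2 with hK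
  have hK0 : 0 ≤ K := by positivity
  set f : ℕ → ℂ := fun n => if (n : ℝ) ≤ P1pp D * etaPM D (-1) ∨ P2pp D * etaPM D 1 ≤ (n : ℝ) then
      dualTerm χ x s n else 0 with hf
  have hle : ∀ n : ℕ, ‖f n‖ ≤ K * (1 / (n : ℝ) ^ 2) := by
    intro n
    rcases Nat.eq_zero_or_pos n with rfl | hn
    · have h0 : f 0 = 0 := by
        simp only [hf]
        split_ifs
        · exact dualTerm_zero χ x hs
        · rfl
      rw [h0, norm_zero, Nat.cast_zero]
      simp
    · simp only [hf]
      split_ifs with htail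
      · exact norm_dualTerm_tail_le χ x hℓ hκ hD0 hs hn htail
      · rw [norm_zero]; positivity
  have hg : HasSum (fun n : ℕ => K * (1 / (n : ℝ) ^ 2)) (K * (π ^ 2 / 6)) :=
    hasSum_zeta_two.mul_left K
  have hsf : Summable fun n => ‖f n‖ :=
    Summable.of_nonneg_of_le (fun n => norm_nonneg _) hle hg.summable
  have hT : ‖∑' n, f n‖ ≤ K * (π ^ 2 / 6) :=
    le_trans (norm_tsum_le_tsum_norm hsf) (hasSum_le hle hsf.hasSum hg)
  -- assemble
  rw [norm_mul, hpref]
  have hP2 := P2pp_sq_le hD0 hℓ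
  have hπ : π ^ 2 ≤ 16 := by nlinarith [Real.pi_pos, Real.pi_lt_four]
  have hexp : 2 * (ell D ^ 10)⁻¹ - ell D ^ 10 + (ell D ^ 9 + 1040 * ell D) ≤
      -(1 / 2) * ell D ^ 10 := by
    have h8 : (65536 : ℝ) ≤ ell D ^ 8 := by
      have h := pow_le_pow_left₀ (by norm_num : (0 : ℝ) ≤ 4) hℓ4 8
      norm_num at h
      linarith
    have h9 : 65536 * ell D ≤ ell D ^ 9 := by
      calc 65536 * ell D ≤ ell D ^ 8 * ell D := mul_le_mul_of_nonneg_right h8 hℓ.le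
        _ = ell D ^ 9 := by ring
    have h10 : 4 * ell D ^ 9 ≤ ell D ^ 10 := by
      calc 4 * ell D ^ 9 ≤ ell D * ell D ^ 9 := mul_le_mul_of_nonneg_right hℓ4 (by positivity)
        _ = ell D ^ 10 := by ring
    linarith
  calc 1 / 0.504 * ‖∑' n, f n‖ ≤ 1 / 0.504 * (K * (π ^ 2 / 6)) := by gcongr
    _ ≤ 1 / 0.504 * (0.004 * Real.exp (2 * (ell D ^ 10)⁻¹ - ell D ^ 10) *
          Real.exp (ell D ^ 9 + 1040 * ell D) * (16 / 6)) := by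
        rw [hK]; gcongr
    _ = (1 / 0.504 * 0.004 * (16 / 6)) *
          Real.exp (2 * (ell D ^ 10)⁻¹ - ell D ^ 10 + (ell D ^ 9 + 1040 * ell D)) := by
        simp only [Real.exp_add]; ring
    _ ≤ 1 * Real.exp (2 * (ell D ^ 10)⁻¹ - ell D ^ 10 + (ell D ^ 9 + 1040 * ell D)) := by
        gcongr; norm_num
    _ ≤ 1 * Real.exp (-(1 / 2) * ell D ^ 10) := by gcongr

end DualTails


/-! ## Discharge: the edge estimate for `ϰ₁₂ − ϰ₁` (§12 p. 67, tex L3408; DAG Z22:§12.u006)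

`Vk12SubVk1Edges` is a THEOREM: near `P^{0.5}` both `|ϰ₁₂(n)| ≤ 0.004/0.504` (`0 < g < 1`) and
`|ϰ₁(n)| ≤ 1`; near `P₁`, `|ϰ₁(n)| = log(P₁/n)/log P₁ ≤ 𝓛⁻¹⁰/log P₁` and
`∫_{0.5}^{0.504}{g(P^z/n) − g(P^{0.5}/n)}dz` splits at `z* = 0.504 − 2𝓛⁻¹⁹`: below `z*` both `g`'s are
`≤ ½e^{−𝓛¹⁰}` by (4.3), above `z*` the integrand is `< 1` on a window of length `2𝓛⁻¹⁹`.
Constants: `C = 7`, `D ≥ e²`. -/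

section Edges

variable {D : ℕ}

/-- `‖ϰ₁₂(y)‖ = (1/0.504)|∫_{0.5}^{0.504}{g(P^z/y) − g(P^{0.5}/y)}dz|` for `y > 0` (`|(P₁/y)^{β₆}| = 1`).
[cite: Zhang2022LandauSiegel, §12 p. 66] -/
theorem norm_vk12_eq (hP1 : 0 < Skeleton.P1 D) {y : ℝ} (hy : 0 < y) :
    ‖vk12 D y‖ = 1 / 0.504 *
      |∫ z in (0.5 : ℝ)..0.504, (gW D (bigP D ^ z / y) - gW D (bigP D ^ (0.5 : ℝ) / y))| := by
  rw [vk12, norm_mul, norm_mul, norm_cpow_beta6 (div_pos hP1 hy), Complex.norm_real,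
    Complex.norm_real, Real.norm_eq_abs, Real.norm_eq_abs,
    abs_of_pos (by norm_num : (0 : ℝ) < 1 / 0.504), mul_one]

/-- `|g(a) − g(b)| ≤ 1` ("`0 < g(x) < 1`", §4 after (4.1)). [cite: Zhang2022LandauSiegel, §4 (4.1) p. 18] -/
theorem abs_gW_sub_gW_le_one (hℓ : 0 < ell D) (a b : ℝ) : |gW D a - gW D b| ≤ 1 := by
  have hΛ : 0 < ell D ^ 30 := pow_pos hℓ 30
  have h1 : 0 < gW D a := GaussWeight.gWeight_pos hΛ a
  have h2 : gW D a < 1 := GaussWeight.gWeight_lt_one hΛ a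
  have h3 : 0 < gW D b := GaussWeight.gWeight_pos hΛ b
  have h4 : gW D b < 1 := GaussWeight.gWeight_lt_one hΛ b
  exact abs_le.mpr ⟨by linarith, by linarith⟩

/-- `‖ϰ₁(n)‖ ≤ 1` for `n ≥ 1` (`0 ≤ log n ≤ log P₁` below `P₁`, `ϰ₁ = 0` above).
[cite: Zhang2022LandauSiegel, §8 (8.6) p. 44] -/
theorem norm_vk1_le_one (hP1 : 1 < Skeleton.P1 D) {n : ℕ} (hn : 1 ≤ n) : ‖vk1 D n‖ ≤ 1 := by
  rw [vk1]
  split_ifs with h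
  · have hn0 : (0 : ℝ) < n := by exact_mod_cast hn
    have hlogP : 0 < Real.log (Skeleton.P1 D) := Real.log_pos hP1
    have hlog0 : 0 ≤ Real.log n := Real.log_nonneg (by exact_mod_cast hn)
    have hlog1 : Real.log n ≤ Real.log (Skeleton.P1 D) := Real.log_le_log hn0 h.le
    rw [norm_mul, norm_cpow_beta6 (div_pos (by linarith) hn0), mul_one, Complex.norm_real,
      Real.norm_eq_abs]
    have hq1 : Real.log n / Real.log (Skeleton.P1 D) ≤ 1 := (div_le_one hlogP).mpr hlog1
    have hq0 : 0 ≤ Real.log n / Real.log (Skeleton.P1 D) := div_nonneg hlog0 hlogP.le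
    exact abs_le.mpr ⟨by linarith, by linarith⟩
  · simp

/-- Near `P₁` (`n ≥ P₁η₋`): `‖ϰ₁(n)‖ ≤ 𝓛⁻¹⁰/log P₁` (`log(P₁/n) ≤ log η₋⁻¹ = 𝓛⁻¹⁰`).
[cite: Zhang2022LandauSiegel, §12 p. 67] -/
theorem norm_vk1_le_near (hℓ : 0 < ell D) {n : ℕ} (hn1 : Skeleton.P1 D * etaPM D (-1) ≤ n) :
    ‖vk1 D n‖ ≤ (ell D ^ 10)⁻¹ / Real.log (Skeleton.P1 D) := by
  have hP0 : 0 < bigP D := Real.exp_pos _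
  have hP1 : 0 < Skeleton.P1 D := Real.rpow_pos_of_pos hP0 _
  have hlogP : 0 < Real.log (Skeleton.P1 D) := by rw [log_P1]; positivity
  have hm : 0 < (ell D ^ 10)⁻¹ := inv_pos.mpr (pow_pos hℓ 10)
  have hn0 : (0 : ℝ) < n := lt_of_lt_of_le (mul_pos hP1 (Real.exp_pos _)) hn1
  rw [vk1]
  split_ifs with h
  · rw [norm_mul, norm_cpow_beta6 (div_pos hP1 hn0), mul_one, Complex.norm_real, Real.norm_eq_abs]
    have hle : Real.log (Skeleton.P1 D) - Real.log n ≤ (ell D ^ 10)⁻¹ := by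
      have h0 : Skeleton.P1 D * etaPM D (-1) =
          Real.exp (Real.log (Skeleton.P1 D) + -(ell D ^ 10)⁻¹) := by
        rw [Real.exp_add, Real.exp_log hP1, etaPM, neg_one_mul]
      have h1 : Real.exp (Real.log (Skeleton.P1 D) + -(ell D ^ 10)⁻¹) ≤ n := by
        rw [← h0]; exact hn1
      have h2 := Real.log_le_log (Real.exp_pos _) h1
      rw [Real.log_exp] at h2
      linarith
    have hge : Real.log n ≤ Real.log (Skeleton.P1 D) := Real.log_le_log hn0 h.le
    have heq : 1 - Real.log n / Real.log (Skeleton.P1 D) =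
        (Real.log (Skeleton.P1 D) - Real.log n) / Real.log (Skeleton.P1 D) := by
      field_simp
    rw [heq, abs_of_nonneg (div_nonneg (by linarith) hlogP.le)]
    exact div_le_div_of_nonneg_right hle hlogP.le
  · rw [norm_zero]; positivity

/-- Near `P₁` (`n ≥ P₁η₋`, `𝓛 ≥ 2`): `|∫_{0.5}^{0.504}{g(P^z/n) − g(P^{0.5}/n)}dz| ≤ 0.004e^{−𝓛¹⁰} + 2𝓛⁻¹⁹`
(split at `z* = 0.504 − 2𝓛⁻¹⁹`). [cite: Zhang2022LandauSiegel, §12 p. 67] -/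
theorem abs_int_vk12_near_P1 (hℓ2 : 2 ≤ ell D) {n : ℕ} (hn1 : Skeleton.P1 D * etaPM D (-1) ≤ n) :
    |∫ z in (0.5 : ℝ)..0.504, (gW D (bigP D ^ z / n) - gW D (bigP D ^ (0.5 : ℝ) / n))| ≤
      0.004 * Real.exp (-(ell D ^ 10)) + 2 * (ell D ^ 10)⁻¹ / ell D ^ 9 := by
  have hℓ : 0 < ell D := by linarith
  have hL0 : 0 < ell D ^ 9 := pow_pos hℓ 9
  have hL0' : ell D ^ 9 ≠ 0 := hL0.ne'
  have hm : 0 < (ell D ^ 10)⁻¹ := inv_pos.mpr (pow_pos hℓ 10)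
  have hP1le : 1 ≤ bigP D := one_le_bigP' D
  have hP0 : 0 < bigP D := Real.exp_pos _
  have hP1 : 0 < Skeleton.P1 D := Real.rpow_pos_of_pos hP0 _
  have hn0 : (0 : ℝ) < n := lt_of_lt_of_le (mul_pos hP1 (Real.exp_pos _)) hn1
  -- sizes: `𝓛⁻¹⁰ ≤ 1/1024`, `𝓛⁹ ≥ 512`
  have hm_small : (ell D ^ 10)⁻¹ ≤ 1 / 1024 := by
    have h10 : (1024 : ℝ) ≤ ell D ^ 10 := by
      have h := pow_le_pow_left₀ (by norm_num : (0 : ℝ) ≤ 2) hℓ2 10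
      norm_num at h
      exact h
    rw [one_div]
    exact inv_anti₀ (by norm_num) h10
  have hL9 : (512 : ℝ) ≤ ell D ^ 9 := by
    have h := pow_le_pow_left₀ (by norm_num : (0 : ℝ) ≤ 2) hℓ2 9
    norm_num at h
    exact h
  set zs : ℝ := 0.504 - 2 * (ell D ^ 10)⁻¹ / ell D ^ 9 with hzs
  have hδ : 0 ≤ 2 * (ell D ^ 10)⁻¹ / ell D ^ 9 := by positivity
  have hδ' : 2 * (ell D ^ 10)⁻¹ / ell D ^ 9 ≤ 0.004 := by
    have h1 : 2 * (ell D ^ 10)⁻¹ / ell D ^ 9 ≤ 2 * (ell D ^ 10)⁻¹ :=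
      div_le_self (by positivity) (by linarith)
    linarith
  have hzs1 : 0.5 ≤ zs := by rw [hzs]; linarith
  have hzs2 : zs ≤ 0.504 := by rw [hzs]; linarith
  -- the integrand and its integrability
  set F : ℝ → ℝ := fun z => gW D (bigP D ^ z / n) - gW D (bigP D ^ (0.5 : ℝ) / n) with hF
  have hmono : Monotone F := by
    intro z₁ z₂ hz
    have h1 : bigP D ^ z₁ / n ≤ bigP D ^ z₂ / n :=
      div_le_div_of_nonneg_right (Real.rpow_le_rpow_of_exponent_le hP1le hz) hn0.le
    have h2 : gW D (bigP D ^ z₁ / n) ≤ gW D (bigP D ^ z₂ / n) :=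
      GaussWeight.gWeight_mono (pow_pos hℓ 30) (div_pos (Real.rpow_pos_of_pos hP0 _) hn0) h1
    simp only [hF]
    linarith
  have hint : ∀ a b : ℝ, IntervalIntegrable F MeasureTheory.volume a b :=
    fun a b => hmono.intervalIntegrable
  have hsplit : ∫ z in (0.5 : ℝ)..0.504, F z = (∫ z in (0.5 : ℝ)..zs, F z) + ∫ z in zs..0.504, F z :=
    (intervalIntegral.integral_add_adjacent_intervals (hint _ _) (hint _ _)).symm
  -- lower endpoint of `n` on the logarithmic scale
  have hn1' : Real.exp (ell D ^ 9 * 0.504 + -(ell D ^ 10)⁻¹) ≤ n := by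
    have h1 : Skeleton.P1 D * etaPM D (-1) = Real.exp (ell D ^ 9 * 0.504 + -(ell D ^ 10)⁻¹) := by
      rw [Skeleton.P1, bigP, ← Real.exp_mul, etaPM, neg_one_mul, ← Real.exp_add]
    rw [← h1]; exact hn1
  have key : ∀ w : ℝ, w ≤ zs → bigP D ^ w / n ≤ Real.exp (-(ell D ^ 10)⁻¹) := by
    intro w hw
    rw [div_le_iff₀ hn0]
    calc bigP D ^ w = Real.exp (ell D ^ 9 * w) := by rw [bigP, ← Real.exp_mul]
      _ ≤ Real.exp (ell D ^ 9 * zs) := Real.exp_le_exp.mpr (mul_le_mul_of_nonneg_left hw hL0.le)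
      _ = Real.exp (-(ell D ^ 10)⁻¹) * Real.exp (ell D ^ 9 * 0.504 + -(ell D ^ 10)⁻¹) := by
          rw [← Real.exp_add]
          congr 1
          rw [hzs]
          field_simp
          ring
      _ ≤ Real.exp (-(ell D ^ 10)⁻¹) * n := mul_le_mul_of_nonneg_left hn1' (Real.exp_pos _).le
  -- bound on `[0.5, z*]`: both `g`'s are `≤ ½e^{−𝓛¹⁰}`
  have hA : ∀ z ∈ Set.uIoc (0.5 : ℝ) zs, ‖F z‖ ≤ Real.exp (-(ell D ^ 10)) := by
    intro z hz
    rw [Set.uIoc_of_le hzs1, Set.mem_Ioc] at hz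
    have h1 : gW D (bigP D ^ z / n) ≤ 1 / 2 * Real.exp (-(ell D ^ 10)) :=
      gW_le_of_le_exp_neg hℓ (div_pos (Real.rpow_pos_of_pos hP0 _) hn0) (key z hz.2)
    have h2 : gW D (bigP D ^ (0.5 : ℝ) / n) ≤ 1 / 2 * Real.exp (-(ell D ^ 10)) :=
      gW_le_of_le_exp_neg hℓ (div_pos (Real.rpow_pos_of_pos hP0 _) hn0) (key 0.5 hzs1)
    have g1 : 0 < gW D (bigP D ^ z / n) := GaussWeight.gWeight_pos (pow_pos hℓ 30) _
    have g2 : 0 < gW D (bigP D ^ (0.5 : ℝ) / n) := GaussWeight.gWeight_pos (pow_pos hℓ 30) _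
    simp only [hF]
    rw [Real.norm_eq_abs]
    exact abs_le.mpr ⟨by linarith, by linarith⟩
  -- bound on `[z*, 0.504]`: the integrand is `≤ 1`
  have hB : ∀ z ∈ Set.uIoc zs (0.504 : ℝ), ‖F z‖ ≤ 1 := by
    intro z _
    simp only [hF]
    rw [Real.norm_eq_abs]
    exact abs_gW_sub_gW_le_one hℓ _ _
  have hIA := intervalIntegral.norm_integral_le_of_norm_le_const hA
  have hIB := intervalIntegral.norm_integral_le_of_norm_le_const hB
  rw [Real.norm_eq_abs] at hIA hIB
  have e1 : |zs - 0.5| ≤ 0.004 := by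
    rw [abs_of_nonneg (by linarith), hzs]; linarith
  have e2 : |0.504 - zs| = 2 * (ell D ^ 10)⁻¹ / ell D ^ 9 := by
    rw [abs_of_nonneg (by linarith), hzs]; ring
  have hE : 0 ≤ Real.exp (-(ell D ^ 10)) := (Real.exp_pos _).le
  rw [hsplit]
  calc |(∫ z in (0.5 : ℝ)..zs, F z) + ∫ z in zs..0.504, F z|
      ≤ |∫ z in (0.5 : ℝ)..zs, F z| + |∫ z in zs..0.504, F z| := abs_add_le _ _
    _ ≤ Real.exp (-(ell D ^ 10)) * |zs - 0.5| + 1 * |0.504 - zs| := add_le_add hIA hIB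
    _ ≤ Real.exp (-(ell D ^ 10)) * 0.004 + 1 * (2 * (ell D ^ 10)⁻¹ / ell D ^ 9) := by
        rw [e2]
        exact add_le_add (mul_le_mul_of_nonneg_left e1 hE) le_rfl
    _ = 0.004 * Real.exp (-(ell D ^ 10)) + 2 * (ell D ^ 10)⁻¹ / ell D ^ 9 := by ring

/-- **DAG node Z22:§12.u006 DISCHARGED**: `Vk12SubVk1Edges` holds (`C = 7`, every `D ≥ e²`):
`|ϰ₁₂(n) − ϰ₁(n)| ≤ 7𝓛⁻¹⁰` for `P₁η₋ ≤ n < P₁η₊` and `≤ 7` for `P^{0.5}η₋ < n ≤ P^{0.5}η₊`.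
[cite: Zhang2022LandauSiegel, §12 p. 67] -/
theorem vk12SubVk1Edges_holds : Vk12SubVk1Edges := by
  refine ⟨7, ⌈Real.exp 2⌉₊, fun D _ χ hD _ _ n => ?_⟩
  -- parameters
  have hD2 : Real.exp 2 ≤ D := le_trans (Nat.le_ceil _) (by exact_mod_cast hD)
  have hD0 : (0 : ℝ) < D := lt_of_lt_of_le (Real.exp_pos 2) hD2
  have hℓ2 : 2 ≤ ell D := by rw [ell, Real.le_log_iff_exp_le hD0]; exact hD2
  have hℓ : 0 < ell D := by linarith
  have hL0 : 0 < ell D ^ 9 := pow_pos hℓ 9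
  have hL9 : (512 : ℝ) ≤ ell D ^ 9 := by
    have h := pow_le_pow_left₀ (by norm_num : (0 : ℝ) ≤ 2) hℓ2 9
    norm_num at h
    exact h
  have hm : 0 < (ell D ^ 10)⁻¹ := inv_pos.mpr (pow_pos hℓ 10)
  have hP0 : 0 < bigP D := Real.exp_pos _
  have hP1 : 0 < Skeleton.P1 D := Real.rpow_pos_of_pos hP0 _
  have hbigP : 1 < bigP D := by
    rw [bigP]; exact Real.one_lt_exp_iff.mpr (pow_pos hℓ 9)
  have hP1' : 1 < Skeleton.P1 D := Real.one_lt_rpow hbigP (by norm_num)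
  have hlogP : Real.log (Skeleton.P1 D) = 0.504 * ell D ^ 9 := log_P1 D
  have hlogP0 : 1 ≤ Real.log (Skeleton.P1 D) := by rw [hlogP]; linarith
  -- `e^{−𝓛¹⁰} ≤ 𝓛⁻¹⁰`
  have hexpm : Real.exp (-(ell D ^ 10)) ≤ (ell D ^ 10)⁻¹ := by
    rw [Real.exp_neg]
    exact inv_anti₀ (pow_pos hℓ 10) (by linarith [Real.add_one_le_exp (ell D ^ 10)])
  constructor
  · -- near `P₁`
    intro hn1 hn2
    have hn0 : (0 : ℝ) < n := lt_of_lt_of_le (mul_pos hP1 (Real.exp_pos _)) hn1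
    have hA := abs_int_vk12_near_P1 hℓ2 hn1
    have hB := norm_vk1_le_near hℓ hn1
    have h12 : ‖vk12 D n‖ ≤ 1 / 0.504 * (0.004 * Real.exp (-(ell D ^ 10)) +
        2 * (ell D ^ 10)⁻¹ / ell D ^ 9) := by
      rw [norm_vk12_eq hP1 hn0]
      exact mul_le_mul_of_nonneg_left hA (by norm_num)
    have hq1 : 2 * (ell D ^ 10)⁻¹ / ell D ^ 9 ≤ 2 * (ell D ^ 10)⁻¹ :=
      div_le_self (by positivity) (by linarith)
    have hq2 : (ell D ^ 10)⁻¹ / Real.log (Skeleton.P1 D) ≤ (ell D ^ 10)⁻¹ :=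
      div_le_self hm.le hlogP0
    calc ‖vk12 D n - vk1 D n‖ ≤ ‖vk12 D n‖ + ‖vk1 D n‖ := norm_sub_le _ _
      _ ≤ 1 / 0.504 * (0.004 * Real.exp (-(ell D ^ 10)) + 2 * (ell D ^ 10)⁻¹ / ell D ^ 9) +
            (ell D ^ 10)⁻¹ / Real.log (Skeleton.P1 D) := add_le_add h12 hB
      _ ≤ 1 / 0.504 * (0.004 * (ell D ^ 10)⁻¹ + 2 * (ell D ^ 10)⁻¹) + (ell D ^ 10)⁻¹ := by
            gcongr
      _ ≤ 7 * (ell D ^ 10)⁻¹ := by linarith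
  · -- near `P^{0.5}`
    intro hn1 hn2
    have hlow0 : 0 < bigP D ^ (0.5 : ℝ) * etaPM D (-1) :=
      mul_pos (Real.rpow_pos_of_pos hP0 _) (Real.exp_pos _)
    have hn0 : (0 : ℝ) < n := lt_trans hlow0 hn1
    have hn : 1 ≤ n := by exact_mod_cast (show (0 : ℝ) < n from hn0)
    have hI : |∫ z in (0.5 : ℝ)..0.504, (gW D (bigP D ^ z / n) - gW D (bigP D ^ (0.5 : ℝ) / n))| ≤
        1 * |(0.504 : ℝ) - 0.5| := by
      have h := intervalIntegral.norm_integral_le_of_norm_le_const (a := (0.5 : ℝ)) (b := 0.504)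
        (f := fun z => gW D (bigP D ^ z / n) - gW D (bigP D ^ (0.5 : ℝ) / n)) (C := 1)
        (fun z _ => by rw [Real.norm_eq_abs]; exact abs_gW_sub_gW_le_one hℓ _ _)
      rwa [Real.norm_eq_abs] at h
    have h12 : ‖vk12 D n‖ ≤ 1 / 0.504 * (1 * |(0.504 : ℝ) - 0.5|) := by
      rw [norm_vk12_eq hP1 hn0]
      exact mul_le_mul_of_nonneg_left hI (by norm_num)
    have h1 := norm_vk1_le_one hP1' hn
    calc ‖vk12 D n - vk1 D n‖ ≤ ‖vk12 D n‖ + ‖vk1 D n‖ := norm_sub_le _ _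
      _ ≤ 1 / 0.504 * (1 * |(0.504 : ℝ) - 0.5|) + 1 := add_le_add h12 h1
      _ ≤ 7 := by
          rw [abs_of_pos (by norm_num : (0 : ℝ) < 0.504 - 0.5)]
          norm_num

/-- The (12.6)-deduction `Ded126 c'` with its three kernel-proved `ϰ`-inputs (DAG u004/u005/u006:
`intG504_holds`, `vk12SubVk1Small_holds`, `vk12SubVk1Edges_holds`) fed in: what remains are the
`𝔱`-sums (u007/u008) and the §7–§8 inputs. [cite: Zhang2022LandauSiegel, §12 p. 67] -/
theorem ded126_reduced {c' : ℝ} (h : Ded126 c') :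
    FraktRowSmall → FraktDoubleSum → Lemma81 c' → Prop71 c' → Prop22i → Eq126 c' :=
  h intG504_holds vk12SubVk1Small_holds vk12SubVk1Edges_holds

/-- The (12.8)-deduction `Ded128 c'` with its two kernel-proved tail/`g`-integral inputs (DAG u011/u012
and the tails claim: `dualTailsSmall_holds`, `intGDual_holds`) fed in.
[cite: Zhang2022LandauSiegel, §12 p. 67] -/
theorem ded128_reduced {c' : ℝ} (h : Ded128 c') (hFE : Htilde15ApproxFE) :
    E2ShiftMeanSq c' → Lemma81 c' → Prop71 c' → Prop22i → PsiChiPrimitive → Eq128 c' :=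
  h hFE dualTailsSmall_holds intGDual_holds

end Edges

end Literature.NumberTheory.LFunctions.Zhang2022.Typed.Sec12A
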